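import Mathlib.RingTheory.Ideal.KrullsHeightTheorem
import Mathlib.RingTheory.Ideal.GoingDown
import Mathlib.RingTheory.AlgebraicIndependent.Defs
import Literature.Computability.AlgebraicComplexity.VonZurGathenSingPermHeight
import HarnessLib

/-!
# Boralevi–Carlini–Michałek–Ventura 2025, §1–§3: codimension of permanental varieties
(the elementary statements, PROVED)

A. Boralevi, E. Carlini, M. Michałek, E. Ventura, *On the codimension of permanental varieties*,
Adv. Math. 461 (2025) 110079, arXiv:2402.17839 (HELD as `paper:arxiv-2402.17839`; locators
`p000N Lnn` below refer to the materialised arXiv text).  The paper studies the varieties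
`P_{k,n} = {prk(M) ≤ k − 1} ⊆ F^{k×n}` cut out by the `k × k` permanents of a generic `k × n`
matrix and the singular locus `Sing(P) = {prk(M) ≤ k − 2}` of the permanental hypersurface —
von zur Gathen's problem (tree: `VonZurGathenRegularity.lean`, `VonZurGathenSingPermHeight.lean`,
`ABV17SingularLocusBound.lean`; Alper–Bogart–Velasco's `dc(f) ≥ codim Sing(f) + 1`).

This file types and PROVES the elementary numbered statements of §1–§3, in the HEIGHT form used
by the tree for von zur Gathen's Lemma 2.3 ("codimension of a variety" = height of its ideal =
least height of a prime over it; generic point of a prime + explicit chains of kernels, no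
dimension theory beyond Mathlib's going-down height formula):

* Def. 1.1 (p0003) `prk` — permanental rank; the zero set of the `h × h` permanents is
  `{prk ≤ h − 1}` (`forall_rsubperm_eq_zero_iff_prk_lt`); the ideals `subpermIdeal F k n h` of
  `h × h` permanents of the generic `k × n` matrix (`I(P_{k,n})` for `h = k`).
* **Prop. 3.1** (p0006 L3–6, `F` arbitrary): `n − k + 1 ≤ ht I(P_{k,n}) ≤ n` — `prop_3_1`,
  `prop_3_1_lower` (every prime over it), `prop_3_1_upper`; typed for `1 ≤ k ≤ n` ⊇ printed
  `2 ≤ k ≤ n` (the printed induction on `k` with the vacuous base `k = 0` instead of Thm. 2.1, so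
  no characteristic hypothesis enters).
* **Thm. 2.1, codimension clause** (p0005 L6–9): `ht I(P_{2,n}) = n` for `n ≥ 3` — `thm_2_1`
  (every prime), `thm_2_1_height`; typed for `(2 : F) ≠ 0` ⊋ printed `char F = 0`; the clause
  "its singular locus has dimension `1` and consists of `n²` lines" is NOT typed; the printed
  appeal to the Laubenbacher–Swanson decomposition [LS2000] is replaced by an elementary case
  analysis at the generic point.
* **Cor. 3.2** (p0006 L18–31, `F` arbitrary): `codim Sing(P) ≥ 4` — `cor_3_2` (every prime over
  the tree's `VonZurGathen.singPermIdeal F k`, `k ≥ 2`, EVERY field incl. characteristic `2`),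
  `cor_3_2_height`; the bridge `singPermIdeal F k = subpermIdeal F k k (k−1)` is PROVED
  (`singPermIdeal_eq_subpermIdeal`); the clause "`perm(M)` is irreducible over `F`" is the
  tree's `perPoly_irreducible` (vzG Thm. 3.4) — CITED, not restated.  (The tree's
  `vonzurGathen1987_singPerm_height_holds` is the sharper `≥ 5` for `k ≥ 3`, `2 ≠ 0`.)
* **Lemma 3.3** (p0006 L33–36): the `h × h` permanents of a generic matrix are linearly
  independent — `lemma_3_3`, over any commutative ring.
* **Lemma 3.11** (p0007 L90–95): the `2 × 2` permanents of the `k × (k+1)` circulant Hankel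
  matrix generate an ideal of height `k + 1` — `lemma_3_11`, `lemma_3_11_sq_mem` (`x_j² ∈ I`);
  typed for `k ≥ 3` and `(2 : F) ≠ 0` ⊊ printed `k ≥ 2` (the proof divides by `2`; the printed
  `k = 2` check is not typed).
* **Prop. 3.5** (p0006 L43–52): the `k × k` permanents of a generic `k × (k+1)` matrix are
  algebraically independent (`k ≥ 1`) — `prop_3_5`, Mathlib `AlgebraicIndependent`, over EVERY
  commutative ring ⊇ printed (the printed proof — Mignon–Ressayre Hessian nondegeneracy +
  Gordan–Noether — needs characteristic `0`; here the specialisation `M = [s·1_k | t]` sends the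
  permanents to monomials with independent exponents).

NOT typed (by design): Conj. 3.4 (a conjecture — not Literature), Rem. 2.2 / Prop. 2.3 (Hankel
scheme), Props. 3.8, 3.10, 3.14–3.17, Thm. 3.18/3.19 (Macaulay2 computations / Kirkup's nondegenerate ideal), and all of §4
(torus actions, Białynicki-Birula-type tangent-bundle argument) including Thm. 4.23
"`6 ≤ codim Sing(per_k) ≤ 2k` for `k ≥ 6`" — the `≤ 2k` half is the tree's
`alperBogartVelasco2017_rem_1_5`.

Toolkit (§A–§B): `rsubperm` — subpermanents of RECTANGULAR matrices (the tree's `Matrix.subperm`,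
`Literature/LinearAlgebra/Matrix/PermanentSubperm.lean`, is square-only; the row expansion is the
same proof), evaluation / pattern / freed-coordinate lemmas in the idiom of
`VonZurGathenSingPermHeight.lean`, and `height_ker_aeval_comp_le`: heights of generic-point primes
do not drop under restriction of coordinates (Mathlib's going-down height formula for the free
extension `K[X_{σ'}] → K[X_σ]`).

Honest framing: a V0 DICTIONARY row (permanental ideals / singular locus of the permanent;
companion of `ABV2017-A` and the `VonZurGathen*` files), not a V3/V4 proof input; combined with
Alper–Bogart–Velasco Cor. 1.3 these codimension bounds give nothing beyond Mignon–Ressayre's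
`dc(per_n) ≥ n²/2`; no rung of the Valiant ladder moves; VP ≠ VNP is NOT proved.

## References

* [BoraleviCarliniMichalekVentura2025] A. Boralevi, E. Carlini, M. Michałek, E. Ventura, *On the
  codimension of permanental varieties*, Adv. Math. 461 (2025) 110079,
  doi:10.1016/j.aim.2024.110079, arXiv:2402.17839 — Def. 1.1, Thm. 2.1, Prop. 3.1, Cor. 3.2,
  Lemma 3.3, Prop. 3.5, Lemma 3.11.
* [Vonzurgathen1987] J. von zur Gathen, *Permanent and determinant*, Linear Algebra Appl. 96
  (1987) 87–100 — Lemma 2.3 (tree: `VonZurGathenSingPermHeight.lean`).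
* H. Matsumura, *Commutative Algebra*, 13.B Thm. 19 (2) (Mathlib
  `Ideal.height_eq_height_add_of_liesOver_of_hasGoingDown`).
-/

noncomputable section

open Matrix MvPolynomial Finset

namespace Literature.Computability.AlgebraicComplexity

namespace BoraleviCarliniMichalekVentura2025

open VonZurGathen

/-! ### §A. Rectangular subpermanents -/

section RSubperm

variable {ρ κ : Type*} [Fintype ρ] [Fintype κ] [DecidableEq ρ] [DecidableEq κ]
  {R S : Type*} [CommRing R] [CommRing S]

/-- The **subpermanent** of a rectangular matrix `M : Matrix ρ κ R` on the columns satisfying `p`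
and the rows satisfying `q`: `∑_f ∏_{c : p c} M (f c) c` over the bijections `f` from the
`p`-columns to the `q`-rows (`0` unless the two index sets have the same size).  For a square
matrix this is the tree's `Matrix.subperm` (`rsubperm_eq_subperm`, definitionally); it is the
permanent of the submatrix `M_{q,p}` (BCMV: "a `k × k` submatrix of `M` whose permanent is
nonzero", Def. 1.1). [cite: BoraleviCarliniMichalekVentura2025, Def. 1.1 (arXiv p0003)] -/
def rsubperm (M : Matrix ρ κ R) (p : κ → Prop) (q : ρ → Prop) [DecidablePred p]
    [DecidablePred q] : R :=
  ∑ f : {c // p c} ≃ {r // q r}, ∏ c : {c // p c}, M (f c) c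

omit [Fintype ρ] [DecidableEq κ] in
/-- On a square matrix the rectangular subpermanent is `Matrix.subperm`. [cite: BurgisserClausenShokrollahi1997, (21.30)] -/
theorem rsubperm_eq_subperm {ι : Type*} [Fintype ι] [DecidableEq ι] (M : Matrix ι ι R)
    (p q : ι → Prop) [DecidablePred p] [DecidablePred q] : rsubperm M p q = M.subperm p q := rfl

/-- The subpermanent only depends on the two index sets. [cite: BurgisserClausenShokrollahi1997, (21.30)] -/
theorem rsubperm_congr (M : Matrix ρ κ R) {p p' : κ → Prop} {q q' : ρ → Prop} [DecidablePred p]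
    [DecidablePred p'] [DecidablePred q] [DecidablePred q'] (hp : ∀ i, p i ↔ p' i)
    (hq : ∀ j, q j ↔ q' j) : rsubperm M p q = rsubperm M p' q' := by
  have hp' : p = p' := funext fun i => propext (hp i)
  have hq' : q = q' := funext fun j => propext (hq j)
  subst hp' hq'
  congr

/-- Naturality under ring homomorphisms. [cite: BurgisserClausenShokrollahi1997, (21.30)] -/
theorem rsubperm_map (f : R →+* S) (M : Matrix ρ κ R) (p : κ → Prop) (q : ρ → Prop)
    [DecidablePred p] [DecidablePred q] : rsubperm (M.map f) p q = f (rsubperm M p q) := by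
  unfold rsubperm
  rw [map_sum]
  refine Finset.sum_congr rfl fun g _ => ?_
  rw [map_prod]
  rfl

/-- A subpermanent only depends on the entries in the kept rows and columns. [cite: BurgisserClausenShokrollahi1997, (21.30)] -/
theorem rsubperm_congr_entries {M N : Matrix ρ κ R} {p : κ → Prop} {q : ρ → Prop}
    [DecidablePred p] [DecidablePred q] (h : ∀ r c, q r → p c → M r c = N r c) :
    rsubperm M p q = rsubperm N p q := by
  unfold rsubperm
  refine Finset.sum_congr rfl fun g _ => Finset.prod_congr rfl fun i _ => ?_
  exact h _ _ (g i).2 i.2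

/-- The subpermanent on two empty index sets is `1`. [cite: BurgisserClausenShokrollahi1997, (21.30)] -/
theorem rsubperm_of_isEmpty (M : Matrix ρ κ R) {p : κ → Prop} {q : ρ → Prop} [DecidablePred p]
    [DecidablePred q] (hp : ∀ i, ¬ p i) (hq : ∀ j, ¬ q j) : rsubperm M p q = 1 := by
  haveI : IsEmpty {i // p i} := ⟨fun x => hp x x.2⟩
  haveI : IsEmpty {j // q j} := ⟨fun y => hq y y.2⟩
  haveI : Unique ({i // p i} ≃ {j // q j}) :=
    { default := Equiv.equivOfIsEmpty _ _
      uniq := fun f => Equiv.ext fun x => isEmptyElim x }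
  unfold rsubperm
  rw [Fintype.sum_unique, Fintype.prod_empty]

/-- A subpermanent of index sets of different sizes vanishes (no bijections). [cite: BurgisserClausenShokrollahi1997, (21.30)] -/
theorem rsubperm_eq_zero_of_card_ne (M : Matrix ρ κ R) {p : κ → Prop} {q : ρ → Prop}
    [DecidablePred p] [DecidablePred q]
    (h : Fintype.card {i // p i} ≠ Fintype.card {j // q j}) : rsubperm M p q = 0 := by
  haveI : IsEmpty ({i // p i} ≃ {j // q j}) :=
    ⟨fun e => h (Fintype.card_congr e)⟩
  unfold rsubperm
  exact Fintype.sum_empty _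

/-- A subpermanent supported on a permutation pattern equals `1`. [cite: BurgisserClausenShokrollahi1997, (21.30)] -/
theorem rsubperm_eq_one_of_pattern (M : Matrix ρ κ R) {p : κ → Prop} {q : ρ → Prop}
    [DecidablePred p] [DecidablePred q] (e : {i // p i} ≃ {j // q j}) (h1 : ∀ i, M (e i) i = 1)
    (h0 : ∀ (i : {i // p i}) (j : {j // q j}), j ≠ e i → M j i = 0) : rsubperm M p q = 1 := by
  unfold rsubperm
  rw [Finset.sum_eq_single e]
  · simp [h1]
  · intro f _ hf
    obtain ⟨i, hi⟩ : ∃ i, f i ≠ e i := by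
      by_contra hall
      push Not at hall
      exact hf (Equiv.ext hall)
    exact Finset.prod_eq_zero (Finset.mem_univ i) (h0 i (f i) hi)
  · intro h
    exact absurd (Finset.mem_univ e) h

section Row

variable {p : κ → Prop} {q : ρ → Prop} {i : κ} {j₀ : ρ} (hpi : p i) (hj₀ : q j₀)

omit [Fintype ρ] [Fintype κ] [DecidableEq ρ] [DecidableEq κ] in
/-- Restricting a bijection with `f i = j₀` to the other columns and rows (rectangular version
of `Matrix.subpermRestrict`). [folklore] -/
private def rRestrict (f : {i // p i} ≃ {j // q j}) (hf : f ⟨i, hpi⟩ = ⟨j₀, hj₀⟩) :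
    {x // p x ∧ x ≠ i} ≃ {y // q y ∧ y ≠ j₀} where
  toFun x := ⟨f ⟨x, x.2.1⟩, (f ⟨x, x.2.1⟩).2, fun h => x.2.2 (by
    have h' : f ⟨x, x.2.1⟩ = f ⟨i, hpi⟩ := by rw [hf]; exact Subtype.ext h
    exact congrArg Subtype.val (f.injective h'))⟩
  invFun y := ⟨f.symm ⟨y, y.2.1⟩, (f.symm ⟨y, y.2.1⟩).2, fun h => y.2.2 (by
    have h' : f.symm ⟨y, y.2.1⟩ = ⟨i, hpi⟩ := Subtype.ext h
    have h'' : (⟨y, y.2.1⟩ : {j // q j}) = ⟨j₀, hj₀⟩ := by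
      rw [← hf, ← h', Equiv.apply_symm_apply]
    exact congrArg Subtype.val h'')⟩
  left_inv x := Subtype.ext (by simp)
  right_inv y := Subtype.ext (by simp)

omit [Fintype ρ] [Fintype κ] [DecidableEq ρ] [DecidableEq κ] in
/-- Values of the restriction. [folklore] -/
@[simp] private theorem rRestrict_apply_coe (f : {i // p i} ≃ {j // q j}) (hf : f ⟨i, hpi⟩ = ⟨j₀, hj₀⟩)
    (x : {x // p x ∧ x ≠ i}) : (rRestrict hpi hj₀ f hf x : ρ) = f ⟨x, x.2.1⟩ := rfl

omit [Fintype ρ] [Fintype κ] in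
/-- Extending a bijection between the other columns and rows by `i ↦ j₀` (rectangular version of
`Matrix.subpermExtend`). [folklore] -/
private def rExtend (g : {x // p x ∧ x ≠ i} ≃ {y // q y ∧ y ≠ j₀}) : {i // p i} ≃ {j // q j} where
  toFun x := if h : (x : κ) = i then ⟨j₀, hj₀⟩ else ⟨g ⟨x, x.2, h⟩, (g ⟨x, x.2, h⟩).2.1⟩
  invFun y := if h : (y : ρ) = j₀ then ⟨i, hpi⟩ else ⟨g.symm ⟨y, y.2, h⟩, (g.symm ⟨y, y.2, h⟩).2.1⟩
  left_inv x := by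
    by_cases h : (x : κ) = i
    · apply Subtype.ext
      simp [h]
    · have h2 : ((g ⟨x, x.2, h⟩ : {y // q y ∧ y ≠ j₀}) : ρ) ≠ j₀ := (g ⟨x, x.2, h⟩).2.2
      apply Subtype.ext
      simp only [dif_neg h]
      rw [dif_neg h2]
      simp
  right_inv y := by
    by_cases h : (y : ρ) = j₀
    · apply Subtype.ext
      simp [h]
    · have h2 : ((g.symm ⟨y, y.2, h⟩ : {x // p x ∧ x ≠ i}) : κ) ≠ i := (g.symm ⟨y, y.2, h⟩).2.2
      apply Subtype.ext
      simp only [dif_neg h]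
      rw [dif_neg h2]
      simp

omit [Fintype ρ] [Fintype κ] in
/-- The extension sends `i` to `j₀`. [folklore] -/
private theorem rExtend_apply_self (g : {x // p x ∧ x ≠ i} ≃ {y // q y ∧ y ≠ j₀}) :
    rExtend hpi hj₀ g ⟨i, hpi⟩ = ⟨j₀, hj₀⟩ := by
  apply Subtype.ext; simp [rExtend]

omit [Fintype ρ] [Fintype κ] in
/-- The extension agrees with `g` elsewhere. [folklore] -/
private theorem rExtend_apply_of_ne (g : {x // p x ∧ x ≠ i} ≃ {y // q y ∧ y ≠ j₀}) (x : {i // p i})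
    (hx : (x : κ) ≠ i) : (rExtend hpi hj₀ g x : ρ) = g ⟨x, x.2, hx⟩ := by
  simp [rExtend, hx]

/-- **Expansion of a rectangular subpermanent along the row `j₀`** (grouping the bijections by
the column sent to `j₀`; rectangular version of `Matrix.subperm_expand_row`, same proof).
[cite: BurgisserClausenShokrollahi1997, (21.30)] -/
theorem rsubperm_expand_row [DecidablePred p] [DecidablePred q] (M : Matrix ρ κ R) (j₀ : ρ)
    (hj₀ : q j₀) :
    rsubperm M p q = ∑ i ∈ univ.filter p,
      M j₀ i * rsubperm M (fun i' => p i' ∧ i' ≠ i) (fun j => q j ∧ j ≠ j₀) := by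
  classical
  unfold rsubperm
  rw [← Finset.sum_fiberwise_of_maps_to
    (g := fun f : {i // p i} ≃ {j // q j} => (f.symm ⟨j₀, hj₀⟩ : κ)) (t := univ.filter p)
    (fun f _ => Finset.mem_filter.2 ⟨Finset.mem_univ _, (f.symm ⟨j₀, hj₀⟩).2⟩)]
  refine Finset.sum_congr rfl fun i hi => ?_
  rw [Finset.mem_filter] at hi
  obtain ⟨-, hpi⟩ := hi
  have hfib : ∀ f : {i // p i} ≃ {j // q j}, ((f.symm ⟨j₀, hj₀⟩ : κ) = i) ↔
      f ⟨i, hpi⟩ = ⟨j₀, hj₀⟩ := by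
    intro f
    constructor
    · intro h
      have h' : f.symm ⟨j₀, hj₀⟩ = ⟨i, hpi⟩ := Subtype.ext h
      rw [← h', Equiv.apply_symm_apply]
    · intro h
      rw [← h, Equiv.symm_apply_apply]
  rw [Finset.mul_sum]
  refine Finset.sum_bij' (fun f hf => rRestrict hpi hj₀ f ((hfib f).1 (Finset.mem_filter.1 hf).2))
    (fun g _ => rExtend hpi hj₀ g) ?_ ?_ ?_ ?_ ?_
  · intro f _; exact Finset.mem_univ _
  · intro g _
    exact Finset.mem_filter.2 ⟨Finset.mem_univ _, (hfib _).2 (rExtend_apply_self hpi hj₀ g)⟩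
  · intro f hf
    have hfi := (hfib f).1 (Finset.mem_filter.1 hf).2
    ext x
    by_cases hx : (x : κ) = i
    · have : x = ⟨i, hpi⟩ := Subtype.ext hx
      subst this
      rw [rExtend_apply_self, hfi]
    · rw [rExtend_apply_of_ne hpi hj₀ _ _ hx, rRestrict_apply_coe]
  · intro g _
    ext x
    rw [rRestrict_apply_coe, rExtend_apply_of_ne hpi hj₀ _ _ x.2.2]
  · intro f hf
    have hfi := (hfib f).1 (Finset.mem_filter.1 hf).2
    rw [← Finset.mul_prod_erase _ _ (Finset.mem_univ ⟨i, hpi⟩), congrArg Subtype.val hfi]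
    congr 1
    refine Finset.prod_bij'
      (fun x hx => ⟨x.1, x.2, fun h => (Finset.mem_erase.1 hx).1 (Subtype.ext h)⟩)
      (fun x _ => ⟨x.1, x.2.1⟩) ?_ ?_ ?_ ?_ ?_
    · intro x _; exact Finset.mem_univ _
    · intro x _
      exact Finset.mem_erase.2 ⟨fun h => x.2.2 (congrArg Subtype.val h), Finset.mem_univ _⟩
    · intro x _; rfl
    · intro x _; rfl
    · intro x _; rfl

end Row

/-- Expansion of `per[insert x Rw | Cl]` (`x ∉ Rw`) along the row `x`:
`Σ_{c ∈ Cl} M x c · per[Rw | Cl ∖ c]`. [cite: BurgisserClausenShokrollahi1997, (21.30)] -/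
theorem rsubperm_insert_row (M : Matrix ρ κ R) {Rw : Finset ρ} {x : ρ} (hx : x ∉ Rw)
    (Cl : Finset κ) :
    rsubperm M (· ∈ Cl) (· ∈ insert x Rw) =
      ∑ c ∈ Cl, M x c * rsubperm M (· ∈ Cl.erase c) (· ∈ Rw) := by
  rw [rsubperm_expand_row (p := (· ∈ Cl)) (q := (· ∈ insert x Rw)) M x
    (Finset.mem_insert_self _ _), Finset.filter_mem_eq_inter, Finset.univ_inter]
  refine Finset.sum_congr rfl fun c _ => ?_
  congr 1
  exact rsubperm_congr M (fun i => by simp [Finset.mem_erase, and_comm])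
    (fun j => by
      simp only [Finset.mem_insert]
      constructor
      · rintro ⟨h | h, hne⟩
        · exact absurd h hne
        · exact h
      · intro h
        exact ⟨Or.inr h, fun h' => hx (h' ▸ h)⟩)

/-- A `1 × 1` subpermanent is the entry. [cite: BurgisserClausenShokrollahi1997, (21.30)] -/
theorem rsubperm_singleton (M : Matrix ρ κ R) (r : ρ) (c : κ) :
    rsubperm M (· ∈ ({c} : Finset κ)) (· ∈ ({r} : Finset ρ)) = M r c := by
  rw [rsubperm_congr M (p' := (· ∈ ({c} : Finset κ))) (q' := (· ∈ insert r (∅ : Finset ρ)))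
      (fun _ => Iff.rfl) (fun j => by simp),
    rsubperm_insert_row M (Finset.notMem_empty r), Finset.sum_singleton, Finset.erase_singleton,
    rsubperm_of_isEmpty M (fun i => Finset.notMem_empty i) (fun j => Finset.notMem_empty j),
    mul_one]

variable {K : Type*} [CommRing K]

/-- Evaluating a subpermanent of the generic `ρ × κ` matrix at a point `v` gives the
subpermanent of the matrix `(v (r, c))`. [cite: BurgisserClausenShokrollahi1997, (21.30)] -/
theorem aeval_rsubperm_X {A : Type*} [CommRing A] [Algebra K A] (v : ρ × κ → A) (p : κ → Prop)
    (q : ρ → Prop) [DecidablePred p] [DecidablePred q] :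
    aeval v (rsubperm (mvPolynomialX ρ κ K) p q) =
      rsubperm (Matrix.of fun r c => v (r, c)) p q := by
  simp only [rsubperm, map_sum, map_prod, Matrix.mvPolynomialX_apply, aeval_X, Matrix.of_apply]

/-- A square subpermanent of the generic rectangular matrix is a nonzero polynomial (evaluate at
a permutation pattern). [cite: BurgisserClausenShokrollahi1997, (21.30)] -/
theorem rsubperm_X_ne_zero [Nontrivial K] {Rw : Finset ρ} {Cl : Finset κ}
    (h : Cl.card = Rw.card) :
    rsubperm (mvPolynomialX ρ κ K) (· ∈ Cl) (· ∈ Rw) ≠ 0 := by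
  have hcard : Fintype.card {i // i ∈ Cl} = Fintype.card {j // j ∈ Rw} := by simp [h]
  let e : {i // i ∈ Cl} ≃ {j // j ∈ Rw} := Fintype.equivOfCardEq hcard
  let v : ρ × κ → K := fun rc =>
    if hc : rc.2 ∈ Cl then (if ((e ⟨rc.2, hc⟩ : {j // j ∈ Rw}) : ρ) = rc.1 then 1 else 0) else 0
  intro h0
  have h1 : aeval v (rsubperm (mvPolynomialX ρ κ K) (· ∈ Cl) (· ∈ Rw)) = 1 := by
    rw [aeval_rsubperm_X]
    refine rsubperm_eq_one_of_pattern _ e (fun i => ?_) (fun i j hj => ?_)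
    · simp [v, i.2]
    · have hne : ((e ⟨i, i.2⟩ : {j // j ∈ Rw}) : ρ) ≠ j := fun h' =>
        hj (Subtype.ext (by simpa using h'.symm))
      simp [v, i.2, hne]
  rw [h0, map_zero] at h1
  exact zero_ne_one h1

variable {L : Type*} [CommRing L] [Algebra K L]

/-- **Outer dependence**: a subpermanent avoiding the freed positions `T` takes the same value
at `a^T = T.piecewise X (C ∘ a)` as at `a` (up to `C`). [cite: BoraleviCarliniMichalekVentura2025, proof of Prop. 3.1 (arXiv text p0006 L9–17)] -/
theorem rsubperm_piecewise_eq_C (a : ρ × κ → L) (T : Finset (ρ × κ)) {p : κ → Prop}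
    {q : ρ → Prop} [DecidablePred p] [DecidablePred q] (hT : ∀ r c, q r → p c → (r, c) ∉ T) :
    rsubperm (Matrix.of fun r c =>
        (T.piecewise X (C ∘ a) : ρ × κ → MvPolynomial (ρ × κ) L) (r, c)) p q =
      C (rsubperm (Matrix.of fun r c => a (r, c)) p q) := by
  rw [← rsubperm_map (C : L →+* MvPolynomial (ρ × κ) L)]
  refine rsubperm_congr_entries fun r c hq hp => ?_
  simp [Finset.piecewise, hT r c hq hp]

/-- Reindexing the rows along an embedding `e : ρ' ↪ ρ`: the subpermanent of the row-restricted
matrix on the rows `Rw` is the subpermanent of `M` on the rows `e(Rw)`. [cite: BurgisserClausenShokrollahi1997, (21.30)] -/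
theorem rsubperm_rows_embedding {ρ' : Type*} [Fintype ρ'] [DecidableEq ρ'] (M : Matrix ρ κ R)
    (e : ρ' ↪ ρ) (p : κ → Prop) [DecidablePred p] (Rw : Finset ρ') :
    rsubperm (Matrix.of fun r' c => M (e r') c) p (· ∈ Rw) = rsubperm M p (· ∈ Rw.map e) := by
  let η : {r' // r' ∈ Rw} ≃ {r // r ∈ Rw.map e} :=
    Equiv.ofBijective (fun x => ⟨e x, Finset.mem_map_of_mem e x.2⟩)
      ⟨fun x y h => Subtype.ext (e.injective (congrArg Subtype.val h)), fun y => by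
        obtain ⟨x, hx, hxy⟩ := Finset.mem_map.1 y.2
        exact ⟨⟨x, hx⟩, Subtype.ext hxy⟩⟩
  unfold rsubperm
  refine Finset.sum_equiv (Equiv.equivCongr (Equiv.refl _) η) (fun _ => by simp) (fun f _ => ?_)
  refine Finset.prod_congr rfl fun c _ => ?_
  simp [η]

/-- The witness for freeing the row entry `(r₁, j)` — the subpermanent of the generic matrix on
the rows `Rw ∪ {r₁}` and the columns `Cl ∪ {j}` — takes at `a^T` the value it has at `a` (up to
`C`) as long as no position of these rows and columns is freed. [cite: BoraleviCarliniMichalekVentura2025, proof of Prop. 3.1 (arXiv text p0006 L9–17)] -/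
theorem aeval_rowWitness_of_notMem (a : ρ × κ → L) {Rw : Finset ρ} {Cl : Finset κ} {r₁ : ρ}
    {j : κ} {T : Finset (ρ × κ)}
    (hT : ∀ x ∈ T, x.1 ∈ insert r₁ Rw → x.2 ∈ insert j Cl → False) :
    aeval (T.piecewise X (C ∘ a) : ρ × κ → MvPolynomial (ρ × κ) L)
        (rsubperm (mvPolynomialX ρ κ K) (· ∈ insert j Cl) (· ∈ insert r₁ Rw)) =
      C (rsubperm (Matrix.of fun r c => a (r, c)) (· ∈ insert j Cl) (· ∈ insert r₁ Rw)) := by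
  rw [aeval_rsubperm_X]
  exact rsubperm_piecewise_eq_C a T fun r c hr hc hmem => hT _ hmem hr hc

/-- **Rational expression of a freed row entry**: once `(r₁, j)` is freed (and nothing else in the
rows `Rw ∪ {r₁}` and columns `Cl ∪ {j}`), the witness evaluates to `X_{r₁ j} · g(a) + (constant)`
with `g = per[Rw | Cl](a)` (expansion along the row `r₁`; BCMV: "`x_{k,j}|_C` is a rational
function on `C` …", proof of Prop. 3.1). [cite: BoraleviCarliniMichalekVentura2025, proof of Prop. 3.1 (arXiv text p0006)] -/
theorem aeval_rowWitness_of_mem (a : ρ × κ → L) {Rw : Finset ρ} {Cl : Finset κ} {r₁ : ρ} {j : κ}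
    (hr₁ : r₁ ∉ Rw) (hj : j ∉ Cl) {T : Finset (ρ × κ)}
    (hT : ∀ x ∈ T, x.1 ∈ insert r₁ Rw → x.2 ∈ insert j Cl → x = (r₁, j)) (hmem : (r₁, j) ∈ T) :
    aeval (T.piecewise X (C ∘ a) : ρ × κ → MvPolynomial (ρ × κ) L)
        (rsubperm (mvPolynomialX ρ κ K) (· ∈ insert j Cl) (· ∈ insert r₁ Rw)) =
      X (r₁, j) * C (rsubperm (Matrix.of fun r c => a (r, c)) (· ∈ Cl) (· ∈ Rw)) +
        C (∑ c ∈ Cl, a (r₁, c) *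
          rsubperm (Matrix.of fun r c => a (r, c)) (· ∈ (insert j Cl).erase c) (· ∈ Rw)) := by
  have hRw : ∀ (p : κ → Prop) [DecidablePred p], (∀ c, p c → c ∈ insert j Cl) →
      rsubperm (Matrix.of fun r c =>
          (T.piecewise X (C ∘ a) : ρ × κ → MvPolynomial (ρ × κ) L) (r, c)) p (· ∈ Rw) =
        C (rsubperm (Matrix.of fun r c => a (r, c)) p (· ∈ Rw)) := by
    intro p _ hp
    refine rsubperm_piecewise_eq_C a T fun r c hr hc hx => hr₁ ?_
    have h := hT _ hx (Finset.mem_insert_of_mem hr) (hp c hc)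
    rw [Prod.mk.injEq] at h
    exact h.1 ▸ hr
  rw [aeval_rsubperm_X, rsubperm_insert_row _ hr₁ (insert j Cl), Finset.sum_insert hj,
    Finset.erase_insert hj, map_sum]
  congr 1
  · rw [Matrix.of_apply, hRw _ (fun c hc => Finset.mem_insert_of_mem hc)]
    simp [Finset.piecewise, hmem]
  · refine Finset.sum_congr rfl fun c hc => ?_
    rw [map_mul, hRw _ (fun c' hc' => Finset.mem_of_mem_erase hc'), Matrix.of_apply]
    congr 1
    have hc' : (r₁, c) ∉ T := fun hx => hj (by
      have h := hT _ hx (Finset.mem_insert_self _ _) (Finset.mem_insert_of_mem hc)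
      rw [Prod.mk.injEq] at h
      exact h.2 ▸ hc)
    simp [Finset.piecewise, hc']

end RSubperm

/-! ### §B. Generic points and the height of a restriction -/

section GenericPoint

variable {K : Type*} [Field K] {σ : Type*}

/-- The generic point of a prime `P ⊆ K[X_σ]`: for `a = (X mod P)` over the domain `K[X]/P`,
`ker (f ↦ f(a)) = P`. [cite: BoraleviCarliniMichalekVentura2025, proof of Prop. 3.1 (arXiv text p0006 L9–17)] -/
theorem ker_aeval_quotientMk (P : Ideal (MvPolynomial σ K)) [P.IsPrime] :
    RingHom.ker (aeval (R := K) fun x : σ => Ideal.Quotient.mk P (X x)) = P := by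
  have h : (aeval (R := K) fun x : σ => Ideal.Quotient.mk P (X x) :
      MvPolynomial σ K →ₐ[K] _ ⧸ P) = Ideal.Quotient.mkₐ K P :=
    MvPolynomial.algHom_ext fun x => by simp
  ext f
  rw [RingHom.mem_ker, show aeval (R := K) (fun x : σ => Ideal.Quotient.mk P (X x)) f =
    Ideal.Quotient.mk P f by rw [h]; rfl, Ideal.Quotient.eq_zero_iff_mem]

variable {L : Type*} [CommRing L] [IsDomain L] [Algebra K L]

/-- **Heights do not drop under restriction of coordinates** (Sum form): for a point
`a : σ' ⊕ τ → L` over a domain, the prime `{f ∈ K[X_{σ'}] : f(a|σ') = 0}` has height at most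
that of `{f ∈ K[X_{σ' ⊕ τ}] : f(a) = 0}`.  Proof: `K[X_{σ'⊕τ}] = R[X_τ]` for `R = K[X_{σ'}]`
(`MvPolynomial.sumAlgEquiv`), a free hence flat `R`-algebra, so going-down holds and Mathlib's
`Ideal.height_eq_height_add_of_liesOver_of_hasGoingDown` (Matsumura 13.B Thm. 19 (2)) gives
`ht 𝔓 = ht (𝔓 ∩ R) + ht (𝔓 / (𝔓 ∩ R) R[X_τ]) ≥ ht (𝔓 ∩ R)`. [cite: BoraleviCarliniMichalekVentura2025, proof of Prop. 3.1 (arXiv text p0006 L9–17)] -/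
theorem height_ker_aeval_comp_inl_le {σ' τ : Type*} [Finite σ'] [Finite τ] (a : σ' ⊕ τ → L) :
    (RingHom.ker (aeval (R := K) (a ∘ Sum.inl))).height ≤
      (RingHom.ker (aeval (R := K) a)).height := by
  classical
  let Φ : MvPolynomial (σ' ⊕ τ) K ≃ₐ[K] MvPolynomial τ (MvPolynomial σ' K) :=
    (renameEquiv K (Equiv.sumComm σ' τ)).trans (sumAlgEquiv K τ σ')
  haveI hPp : (RingHom.ker (aeval (R := K) a)).IsPrime := RingHom.ker_isPrime _
  let P' : Ideal (MvPolynomial τ (MvPolynomial σ' K)) :=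
    (RingHom.ker (aeval (R := K) a)).comap
      (Φ.symm : MvPolynomial τ (MvPolynomial σ' K) →+* MvPolynomial (σ' ⊕ τ) K)
  haveI hP'p : P'.IsPrime := Ideal.IsPrime.comap _
  -- `Φ⁻¹ ∘ C = rename inl`, so `P' ∩ K[X_{σ'}] = ker (f ↦ f(a ∘ inl))`
  have hΦC : (Φ.symm : MvPolynomial τ (MvPolynomial σ' K) →+* MvPolynomial (σ' ⊕ τ) K).comp
      (algebraMap (MvPolynomial σ' K) (MvPolynomial τ (MvPolynomial σ' K))) =
        (rename (R := K) Sum.inl : MvPolynomial σ' K →ₐ[K] _).toRingHom := by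
    have h : ((Φ.symm : MvPolynomial τ (MvPolynomial σ' K) →ₐ[K] MvPolynomial (σ' ⊕ τ) K).comp
        (IsScalarTower.toAlgHom K (MvPolynomial σ' K) (MvPolynomial τ (MvPolynomial σ' K)))) =
          rename Sum.inl := by
      refine MvPolynomial.algHom_ext fun i => ?_
      rw [AlgHom.comp_apply, IsScalarTower.toAlgHom_apply, MvPolynomial.algebraMap_eq, rename_X]
      change (rename (Equiv.sumComm σ' τ).symm) ((sumAlgEquiv K τ σ').symm (C (X i))) = _
      rw [sumAlgEquiv_symm_C_X, rename_X]
      rfl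
    exact congrArg AlgHom.toRingHom h
  have hunder : P'.under (MvPolynomial σ' K) = RingHom.ker (aeval (R := K) (a ∘ Sum.inl)) := by
    rw [Ideal.under_def, Ideal.comap_comap, hΦC]
    ext f
    rw [Ideal.mem_comap, RingHom.mem_ker, RingHom.mem_ker, AlgHom.toRingHom_eq_coe,
      RingHom.coe_coe, MvPolynomial.aeval_rename]
  -- going down for the free `K[X_{σ'}]`-algebra `K[X_{σ'}][X_τ]`
  have hgd := Ideal.height_eq_height_add_of_liesOver_of_hasGoingDown
    (P'.under (MvPolynomial σ' K)) P'
  have hle : (P'.under (MvPolynomial σ' K)).height ≤ P'.height := by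
    rw [hgd]
    exact le_self_add
  rw [hunder] at hle
  exact hle.trans (le_of_eq (RingEquiv.height_comap Φ.symm.toRingEquiv _))

/-- Heights do not drop under restriction of coordinates along any injection `ι : σ' ↪ σ`.
[cite: BoraleviCarliniMichalekVentura2025, proof of Prop. 3.1 (arXiv text p0006 L9–17)] -/
theorem height_ker_aeval_comp_le {σ' : Type*} [Finite σ] [Finite σ'] (ι : σ' ↪ σ) (a : σ → L) :
    (RingHom.ker (aeval (R := K) (a ∘ ι))).height ≤
      (RingHom.ker (aeval (R := K) a)).height := by
  classical
  haveI : Fintype σ := Fintype.ofFinite σ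
  let e : σ' ⊕ ↥(Set.range ι)ᶜ ≃ σ :=
    (Equiv.sumCongr (Equiv.ofInjective ι ι.injective) (Equiv.refl _)).trans
      (Equiv.Set.sumCompl (Set.range ι))
  have he : (a ∘ e) ∘ Sum.inl = a ∘ ι := by
    funext x
    simp [e]
  have h1 := height_ker_aeval_comp_inl_le (K := K) (a ∘ e)
  rw [he] at h1
  refine h1.trans (le_of_eq ?_)
  -- same height after renaming along `e`
  have hker : RingHom.ker (aeval (R := K) (a ∘ e)) =
      (RingHom.ker (aeval (R := K) a)).comap (renameEquiv K e).toRingEquiv := by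
    ext f
    rw [RingHom.mem_ker, Ideal.mem_comap, RingHom.mem_ker]
    change _ ↔ aeval a (rename e f) = 0
    rw [MvPolynomial.aeval_rename]
  rw [hker]
  exact RingEquiv.height_comap (renameEquiv K e).toRingEquiv _

end GenericPoint

/-! ### §C. The permanental ideals `I(P_{k,n})` and the permanental rank (BCMV Def. 1.1) -/

section Ideals

variable (F : Type*) [CommRing F]

/-- **The ideal of the `h × h` permanents of the generic `k × n` matrix** `(X_{ij})`: the ideal of
`F[X_{k×n}]` generated by the subpermanents `per[Rw | Cl](X)` with `|Rw| = |Cl| = h`.  Its zero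
set is BCMV's permanental variety `{prk(M) ≤ h − 1} ⊆ F^{k×n}` (for `h = k ≤ n` this is
`P_{k,n} = {prk(M) ≤ k−1}`, the variety of maximal permanents, p0004/p0006), see
`forall_rsubperm_eq_zero_iff_prk_lt`. [cite: BoraleviCarliniMichalekVentura2025, §1 Terminology and Prop. 3.1 (arXiv text p0004, p0006)] -/
def subpermIdeal (k n h : ℕ) : Ideal (MvPolynomial (Fin k × Fin n) F) :=
  Ideal.span {f | ∃ Rw : Finset (Fin k), ∃ Cl : Finset (Fin n), Rw.card = h ∧ Cl.card = h ∧
    f = rsubperm (mvPolynomialX (Fin k) (Fin n) F) (· ∈ Cl) (· ∈ Rw)}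

variable {F}

/-- The generators are in the ideal. [cite: BoraleviCarliniMichalekVentura2025, §1 (arXiv text p0004)] -/
theorem rsubperm_mem_subpermIdeal {k n h : ℕ} {Rw : Finset (Fin k)} {Cl : Finset (Fin n)}
    (hR : Rw.card = h) (hC : Cl.card = h) :
    rsubperm (mvPolynomialX (Fin k) (Fin n) F) (· ∈ Cl) (· ∈ Rw) ∈ subpermIdeal F k n h :=
  Ideal.subset_span ⟨Rw, Cl, hR, hC, rfl⟩

/-- `subpermIdeal ≤ P` iff all `h × h` subpermanents of the generic matrix lie in `P`. [cite: BoraleviCarliniMichalekVentura2025, §1 Terminology (arXiv text p0004)] -/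
theorem subpermIdeal_le_iff {k n h : ℕ} {P : Ideal (MvPolynomial (Fin k × Fin n) F)} :
    subpermIdeal F k n h ≤ P ↔ ∀ (Rw : Finset (Fin k)) (Cl : Finset (Fin n)), Rw.card = h →
      Cl.card = h → rsubperm (mvPolynomialX (Fin k) (Fin n) F) (· ∈ Cl) (· ∈ Rw) ∈ P := by
  constructor
  · intro h Rw Cl hR hC
    exact h (rsubperm_mem_subpermIdeal hR hC)
  · intro h
    rw [subpermIdeal, Ideal.span_le]
    rintro f ⟨Rw, Cl, hR, hC, rfl⟩
    exact h Rw Cl hR hC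

variable {ρ κ : Type*} [Fintype ρ] [Fintype κ] [DecidableEq ρ] [DecidableEq κ] {R : Type*}
  [CommRing R]

/-- **Permanental rank** (BCMV Def. 1.1, after Yu [YY]): the largest `h` such that some `h × h`
submatrix of `M` has nonzero permanent (`0` for the zero matrix: the empty subpermanent is `1`).
[cite: BoraleviCarliniMichalekVentura2025, Def. 1.1 (arXiv text p0003)] -/
def prk (M : Matrix ρ κ R) : ℕ :=
  sSup {h | ∃ (Rw : Finset ρ) (Cl : Finset κ), Rw.card = h ∧ Cl.card = h ∧
    rsubperm M (· ∈ Cl) (· ∈ Rw) ≠ 0}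

/-- The sizes of nonvanishing square subpermanents are bounded by the number of rows. [folklore] -/
private theorem prk_set_bddAbove (M : Matrix ρ κ R) :
    BddAbove {h | ∃ (Rw : Finset ρ) (Cl : Finset κ), Rw.card = h ∧ Cl.card = h ∧
      rsubperm M (· ∈ Cl) (· ∈ Rw) ≠ 0} :=
  ⟨Fintype.card ρ, fun _ ⟨Rw, _, hR, _, _⟩ => hR ▸ Finset.card_le_univ Rw⟩

/-- A nonvanishing `h × h` subpermanent gives `h ≤ prk M`. [cite: BoraleviCarliniMichalekVentura2025, Def. 1.1 (arXiv text p0003)] -/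
theorem le_prk_of_rsubperm_ne_zero (M : Matrix ρ κ R) {Rw : Finset ρ} {Cl : Finset κ} {h : ℕ}
    (hR : Rw.card = h) (hC : Cl.card = h) (hne : rsubperm M (· ∈ Cl) (· ∈ Rw) ≠ 0) :
    h ≤ prk M :=
  le_csSup (prk_set_bddAbove M) ⟨Rw, Cl, hR, hC, hne⟩

/-- **`{prk(M) ≤ h−1}` is the zero set of the `h × h` permanents**: for `h ≥ 1`, all `h × h`
subpermanents of `M` vanish iff `prk M < h`. [cite: BoraleviCarliniMichalekVentura2025, Def. 1.1 and §1 Terminology (arXiv text p0003–p0004)] -/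
theorem forall_rsubperm_eq_zero_iff_prk_lt [Nontrivial R] (M : Matrix ρ κ R) {h : ℕ}
    (hh : 1 ≤ h) :
    (∀ (Rw : Finset ρ) (Cl : Finset κ), Rw.card = h → Cl.card = h →
      rsubperm M (· ∈ Cl) (· ∈ Rw) = 0) ↔ prk M < h := by
  classical
  constructor
  · intro hzero
    by_contra hle
    rw [not_lt] at hle
    -- some `h' × h'` subpermanent with `h' = prk M ≥ h` is nonzero; a Laplace/row-expansion
    -- descent shows some `h × h` one is: we argue directly that the sup is attained
    have hne : {h | ∃ (Rw : Finset ρ) (Cl : Finset κ), Rw.card = h ∧ Cl.card = h ∧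
        rsubperm M (· ∈ Cl) (· ∈ Rw) ≠ 0}.Nonempty := ⟨0, ∅, ∅, rfl, rfl, by
      rw [rsubperm_of_isEmpty M (fun i => Finset.notMem_empty i) (fun j => Finset.notMem_empty j)]
      exact one_ne_zero⟩
    obtain ⟨Rw, Cl, hR, hC, hne0⟩ := Nat.sSup_mem hne (prk_set_bddAbove M)
    -- descend from size `prk M` to size `h` by repeatedly expanding along a row
    have key : ∀ (m : ℕ) (Rw : Finset ρ) (Cl : Finset κ), Rw.card = h + m → Cl.card = h + m →
        rsubperm M (· ∈ Cl) (· ∈ Rw) ≠ 0 →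
        ∃ (Rw' : Finset ρ) (Cl' : Finset κ), Rw'.card = h ∧ Cl'.card = h ∧
          rsubperm M (· ∈ Cl') (· ∈ Rw') ≠ 0 := by
      intro m
      induction m with
      | zero => intro Rw Cl hR hC hne0; exact ⟨Rw, Cl, hR, hC, hne0⟩
      | succ m ih =>
        intro Rw Cl hR hC hne0
        obtain ⟨x, hx⟩ : Rw.Nonempty := Finset.card_pos.1 (by omega)
        have hRw : Rw = insert x (Rw.erase x) := (Finset.insert_erase hx).symm
        rw [hRw, rsubperm_insert_row M (Finset.notMem_erase x Rw)] at hne0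
        obtain ⟨c, hc, hne1⟩ := Finset.exists_ne_zero_of_sum_ne_zero hne0
        have hne2 : rsubperm M (· ∈ Cl.erase c) (· ∈ Rw.erase x) ≠ 0 :=
          fun h0 => hne1 (by rw [h0, mul_zero])
        exact ih (Rw.erase x) (Cl.erase c) (by rw [Finset.card_erase_of_mem hx]; omega)
          (by rw [Finset.card_erase_of_mem hc]; omega) hne2
    obtain ⟨m, hm⟩ : ∃ m, prk M = h + m := ⟨prk M - h, by omega⟩
    obtain ⟨Rw', Cl', hR', hC', hne'⟩ := key m Rw Cl (by rw [hR]; exact hm) (by rw [hC]; exact hm)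
      hne0
    exact hne' (hzero Rw' Cl' hR' hC')
  · intro hlt Rw Cl hR hC
    by_contra hne
    exact absurd (le_prk_of_rsubperm_ne_zero M hR hC hne) (not_le.2 hlt)

end Ideals

/-! ### §D. Proposition 3.1: `n − k + 1 ≤ codim P_{k,n} ≤ n` over every field -/

section Prop31

variable {K : Type*} [Field K] {L : Type*} [CommRing L] [IsDomain L] [Algebra K L]

/-- **Prop. 3.1 at a point, lower bound** (BCMV p0006, proof): if all `k × k` subpermanents of
a `k × n` matrix `a` over a domain `L ⊇ K` vanish (`k ≤ n`), the prime `{f : f(a) = 0} ⊆ K[X]`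
has height `≥ n − k + 1`.  The printed induction on `k`: either all `(k−1) × (k−1)`
subpermanents of the first `k − 1` rows vanish (a cone over `P_{k−1,n}`; induction, and heights
do not drop under restriction of coordinates, `height_ker_aeval_comp_le`), or some
`g = per[Rw | Cl](a) ≠ 0` of size `k − 1` misses the row `r₁`, and then each of the `n − k + 1`
coordinates `x_{r₁ j}`, `j ∉ Cl`, "is a rational function" of the others
(`0 = per[all rows | Cl ∪ j](a) = x_{r₁ j} g + …`): freeing them one at a time gives a chain of
`n − k + 1` primes (`height_ker_aeval_piecewise_insert`).  Base of the induction: `k = 0` is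
vacuous (the empty permanent is `1`), so no hypothesis on the characteristic enters (the printed
base is Thm. 2.1). [cite: BoraleviCarliniMichalekVentura2025, Prop. 3.1 (arXiv text p0006 L3–17)] -/
theorem height_ker_aeval_ge_of_maxSubperm_eq_zero :
    ∀ (k n : ℕ), k ≤ n → ∀ (a : Fin k × Fin n → L),
      (∀ Cl : Finset (Fin n), Cl.card = k →
        rsubperm (Matrix.of fun r c => a (r, c)) (· ∈ Cl) (· ∈ (Finset.univ : Finset (Fin k))) =
          0) →
      ((n - k + 1 : ℕ) : ℕ∞) ≤ (RingHom.ker (aeval (R := K) a)).height := by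
  classical
  intro k
  induction k with
  | zero =>
    intro n _ a hvan
    exfalso
    have h := hvan ∅ rfl
    rw [rsubperm_of_isEmpty _ (fun i => Finset.notMem_empty i) (fun j => by simp)] at h
    exact one_ne_zero h
  | succ k ih =>
    intro n hkn a hvan
    by_cases hall : ∀ (Rw : Finset (Fin (k + 1))) (Cl : Finset (Fin n)), Rw.card = k →
        Cl.card = k → rsubperm (Matrix.of fun r c => a (r, c)) (· ∈ Cl) (· ∈ Rw) = 0
    · -- a cone over `P_{k,n}` of the first `k` rows
      let ι : Fin k × Fin n ↪ Fin (k + 1) × Fin n :=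
        Fin.castSuccEmb.prodMap (Function.Embedding.refl (Fin n))
      have hvan' : ∀ Cl : Finset (Fin n), Cl.card = k →
          rsubperm (Matrix.of fun r c => (a ∘ ι) (r, c)) (· ∈ Cl)
            (· ∈ (Finset.univ : Finset (Fin k))) = 0 := by
        intro Cl hC
        have h := rsubperm_rows_embedding (Matrix.of fun r c => a (r, c)) Fin.castSuccEmb
          (· ∈ Cl) (Finset.univ : Finset (Fin k))
        simp only [Matrix.of_apply] at h
        change rsubperm (Matrix.of fun r' c => a (Fin.castSuccEmb r', c)) _ _ = 0
        rw [h]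
        exact hall _ _ (by simp) hC
      have h1 := ih n (by omega) (a ∘ ι) hvan'
      have h2 := height_ker_aeval_comp_le (K := K) ι a
      exact le_trans (by exact_mod_cast (by omega : n - (k + 1) + 1 ≤ n - k + 1)) (h1.trans h2)
    · -- a nonzero `k × k` subpermanent `g = per[Rw | Cl](a)`, `Rw = univ ∖ r₁`
      push Not at hall
      obtain ⟨Rw, Cl, hR, hC, hg⟩ := hall
      obtain ⟨r₁, hr₁⟩ : (Rwᶜ).Nonempty := Finset.card_pos.1 (by
        rw [Finset.card_compl, hR, Fintype.card_fin]; omega)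
      rw [Finset.mem_compl] at hr₁
      have hRw : insert r₁ Rw = Finset.univ := Finset.eq_univ_of_card _ (by
        rw [Finset.card_insert_of_notMem hr₁, hR, Fintype.card_fin])
      -- the freed coordinates `(r₁, j)`, `j ∉ Cl`
      let emb : Fin n ↪ Fin (k + 1) × Fin n := ⟨fun j => (r₁, j), fun j j' h => by
        simpa using h⟩
      set pt : Finset (Fin (k + 1) × Fin n) → Fin (k + 1) × Fin n →
          MvPolynomial (Fin (k + 1) × Fin n) L := fun T => T.piecewise X (C ∘ a) with hpt
      have chain : ∀ S : Finset (Fin n), S ⊆ Clᶜ →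
          (RingHom.ker (aeval (R := K) (pt (S.map emb)))).height + S.card ≤
            (RingHom.ker (aeval (R := K) (pt ∅))).height := by
        intro S
        induction S using Finset.induction_on with
        | empty => intro _; simp
        | insert j S hjS ih' =>
          intro hS
          have hj : j ∉ Cl := Finset.mem_compl.1 (hS (Finset.mem_insert_self _ _))
          have hS' : S ⊆ Clᶜ := fun x hx => hS (Finset.mem_insert_of_mem hx)
          have hmap : (insert j S).map emb = insert (r₁, j) (S.map emb) := by
            rw [Finset.map_insert]
            rfl
          have hT : ∀ x ∈ insert (r₁, j) (S.map emb), x.1 ∈ insert r₁ Rw → x.2 ∈ insert j Cl →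
              x = (r₁, j) := by
            intro x hx _ hc
            rcases Finset.mem_insert.1 hx with rfl | hx'
            · rfl
            · obtain ⟨j', hj', rfl⟩ := Finset.mem_map.1 hx'
              simp only [emb, Function.Embedding.coeFn_mk] at hc
              rcases Finset.mem_insert.1 hc with h | h
              · exact absurd (h ▸ hj') hjS
              · exact absurd h (Finset.mem_compl.1 (hS' hj'))
          have hT0 : ∀ x ∈ S.map emb, x.1 ∈ insert r₁ Rw → x.2 ∈ insert j Cl → False := by
            intro x hx _ hc
            obtain ⟨j', hj', rfl⟩ := Finset.mem_map.1 hx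
            simp only [emb, Function.Embedding.coeFn_mk] at hc
            rcases Finset.mem_insert.1 hc with h | h
            · exact hjS (h ▸ hj')
            · exact Finset.mem_compl.1 (hS' hj') h
          have step := height_ker_aeval_piecewise_insert (K := K) a (S.map emb) (r₁, j)
            (rsubperm (mvPolynomialX (Fin (k + 1)) (Fin n) K) (· ∈ insert j Cl)
              (· ∈ insert r₁ Rw)) ?_ ?_
          · rw [hmap, Finset.card_insert_of_notMem hjS, Nat.cast_succ,
              add_comm (S.card : ℕ∞) 1, ← add_assoc]
            exact (add_le_add step le_rfl).trans (ih' hS')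
          · rw [aeval_rowWitness_of_notMem a hT0, rsubperm_congr _ (fun _ => Iff.rfl)
              (fun r => by rw [hRw]), hvan _ (by rw [Finset.card_insert_of_notMem hj, hC]),
              map_zero]
          · rw [aeval_rowWitness_of_mem a hr₁ hj hT (Finset.mem_insert_self _ _)]
            exact X_mul_C_add_C_ne_zero hg
      have h := chain Clᶜ subset_rfl
      rw [Finset.card_compl, hC, Fintype.card_fin, hpt, ker_aeval_piecewise_empty] at h
      have h' : ((n - k : ℕ) : ℕ∞) ≤ (RingHom.ker (aeval (R := K) a)).height :=
        le_add_self.trans h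
      have hnk : n - (k + 1) + 1 = n - k := by omega
      rw [hnk]
      exact h'

/-- **BCMV Prop. 3.1, lower bound, height form over every field**: for `k ≤ n` every prime
`P ⊆ F[X_{k×n}]` containing all `k × k` permanents of the generic `k × n` matrix has height
`≥ n − k + 1` ("`n − k + 1 ≤ codim(P_{k,n})`"; printed for `k ≥ 2`, here for all `k`).
Typed ⊇ printed (F arbitrary, as printed). [cite: BoraleviCarliniMichalekVentura2025, Prop. 3.1 (arXiv text p0006 L3–6)] -/
theorem prop_3_1_lower (F : Type*) [Field F] {k n : ℕ} (hkn : k ≤ n)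
    (P : Ideal (MvPolynomial (Fin k × Fin n) F)) [P.IsPrime] (hP : subpermIdeal F k n k ≤ P) :
    ((n - k + 1 : ℕ) : ℕ∞) ≤ P.height := by
  classical
  let a : Fin k × Fin n → MvPolynomial (Fin k × Fin n) F ⧸ P := fun x => Ideal.Quotient.mk P (X x)
  have hker := ker_aeval_quotientMk (K := F) P
  have hvan : ∀ Cl : Finset (Fin n), Cl.card = k →
      rsubperm (Matrix.of fun r c => a (r, c)) (· ∈ Cl) (· ∈ (Finset.univ : Finset (Fin k))) =
        0 := by
    intro Cl hC
    rw [← aeval_rsubperm_X (K := F) a, ← RingHom.mem_ker, hker]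
    exact subpermIdeal_le_iff.1 hP _ _ (by simp) hC
  rw [← hker]
  exact height_ker_aeval_ge_of_maxSubperm_eq_zero k n hkn a hvan

/-- Krull's height theorem, packaged: an ideal inside a proper ideal generated by the finite set
`T` has height `≤ |T|`. [folklore] -/
private theorem height_le_card_of_le_span {A : Type*} [CommRing A] [IsNoetherianRing A] {I : Ideal A}
    {T : Finset A} (hle : I ≤ Ideal.span (T : Set A)) (hT : Ideal.span (T : Set A) ≠ ⊤) :
    I.height ≤ T.card := by
  obtain ⟨p, hp⟩ := Ideal.nonempty_minimalPrimes hT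
  exact (Ideal.height_mono (hle.trans hp.1.2)).trans
    (Ideal.height_le_card_of_mem_minimalPrimes_span_finset hp)

/-- An ideal all of whose generators have zero constant term is proper. [folklore] -/
private theorem span_ne_top_of_constantCoeff {A : Type*} [CommRing A] [Nontrivial A] {σ : Type*}
    {S : Set (MvPolynomial σ A)} (h : ∀ g ∈ S, constantCoeff g = 0) :
    Ideal.span S ≠ ⊤ := by
  have hle : Ideal.span S ≤ RingHom.ker (constantCoeff : MvPolynomial σ A →+* A) := by
    rw [Ideal.span_le]
    intro g hg
    rw [SetLike.mem_coe, RingHom.mem_ker]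
    exact h g hg
  exact fun htop => RingHom.ker_ne_top _ (top_le_iff.1 (htop ▸ hle))

/-- **BCMV Prop. 3.1, upper bound** ("we have linear spaces of codimension `n` inside
`P_{k,n}`"): for `1 ≤ k` the ideal of `k × k` permanents of the generic `k × n` matrix lies in
the ideal of the `n` variables of the first row (expand along that row), so its height is
`≤ n` (Krull's height theorem). [cite: BoraleviCarliniMichalekVentura2025, Prop. 3.1 (arXiv text p0006 L7–8)] -/
theorem prop_3_1_upper (F : Type*) [Field F] {k n : ℕ} (hk : 1 ≤ k) :
    (subpermIdeal F k n k).height ≤ n := by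
  classical
  let r₀ : Fin k := ⟨0, hk⟩
  let T : Finset (MvPolynomial (Fin k × Fin n) F) :=
    Finset.univ.image fun j : Fin n => (X (r₀, j) : MvPolynomial (Fin k × Fin n) F)
  have hTcard : T.card ≤ n := by
    have h := Finset.card_image_le (s := Finset.univ)
      (f := fun j : Fin n => (X (r₀, j) : MvPolynomial (Fin k × Fin n) F))
    rwa [Finset.card_univ, Fintype.card_fin] at h
  have hle : subpermIdeal F k n k ≤ Ideal.span (T : Set _) := by
    refine subpermIdeal_le_iff.2 fun Rw Cl hR hC => ?_
    have hRw : Rw = Finset.univ := Finset.eq_univ_of_card _ (by rw [hR, Fintype.card_fin])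
    have hRw' : Rw = insert r₀ (Finset.univ.erase r₀) := by
      rw [hRw, Finset.insert_erase (Finset.mem_univ _)]
    rw [hRw', rsubperm_insert_row _ (Finset.notMem_erase _ _)]
    refine Ideal.sum_mem _ fun c _ => Ideal.mul_mem_right _ _ (Ideal.subset_span ?_)
    exact Finset.mem_coe.2 (Finset.mem_image_of_mem _ (Finset.mem_univ c))
  refine (height_le_card_of_le_span hle (span_ne_top_of_constantCoeff fun g hg => ?_)).trans
    (by exact_mod_cast hTcard)
  obtain ⟨j, -, rfl⟩ := Finset.mem_image.1 (Finset.mem_coe.1 hg)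
  exact constantCoeff_X F _

/-- A lower bound valid for every prime over `I ≠ ⊤` bounds the height of `I` (the height of an
ideal is the infimum of the heights of its minimal primes). [folklore] -/
private theorem le_height_of_forall_isPrime {A : Type*} [CommRing A] {I : Ideal A} {c : ℕ∞}
    (h : ∀ P : Ideal A, P.IsPrime → I ≤ P → c ≤ P.height) : c ≤ I.height := by
  rw [Ideal.height_eq_inf_minimalPrimes]
  exact le_iInf₂ fun P hP => h P hP.1.1 hP.1.2

/-- **BCMV 2025, Proposition 3.1** ("Let `F` be an arbitrary field, `k ≥ 2`, and `M` a generic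
`k × n` matrix of linear forms, with `n ≥ k`. Then the codimension of
`P_{k,n} := {prk(M) ≤ k−1} ⊂ F^{k×n}` satisfies `n − k + 1 ≤ codim(P_{k,n}) ≤ n`."), height
form: `n − k + 1 ≤ ht I(P_{k,n}) ≤ n` for the ideal of `k × k` permanents of the generic `k × n`
matrix (codimension of the variety = height of its ideal = least height of a prime over it).
Typed for `1 ≤ k ≤ n` ⊇ printed `2 ≤ k ≤ n`; "generic matrix of linear forms" = the matrix of
the `kn` coordinates (BCMV's reduction by `GL(kn)`, proof of Thm. 2.1, last paragraph).
[cite: BoraleviCarliniMichalekVentura2025, Prop. 3.1 (arXiv text p0006 L3–6)] -/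
theorem prop_3_1 (F : Type*) [Field F] {k n : ℕ} (hk : 1 ≤ k) (hkn : k ≤ n) :
    ((n - k + 1 : ℕ) : ℕ∞) ≤ (subpermIdeal F k n k).height ∧
      (subpermIdeal F k n k).height ≤ n :=
  ⟨le_height_of_forall_isPrime fun P hP hle => by
    haveI := hP
    exact prop_3_1_lower F hkn P hle,
   prop_3_1_upper F hk⟩

end Prop31

/-! ### §E. Corollary 3.2: `codim Sing(per_k) ≥ 4` over every field -/

section Cor32

variable {K : Type*} [Field K] {L : Type*} [CommRing L] [Algebra K L] {ι : Type*} [Fintype ι]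
  [DecidableEq ι]

variable [IsDomain L]

/-- **Four freed block coordinates, any characteristic** (the first half of vzG's argument, =
BCMV's "similar strategy as in the proof of Prop. 3.1" for Cor. 3.2): `g = per[Rw | Cl](a) ≠ 0`
of size `k`, all `(k+1) × (k+1)` subpermanents of the square matrix `a` vanish, two spare rows
`i₁ ≠ i₂ ∉ Rw` and two spare columns `j₁ ≠ j₂ ∉ Cl`: each block entry `x_{i' j'}` satisfies
`0 = per[Rw ∪ i' | Cl ∪ j'](a) = x_{i'j'} g + …`, so freeing the four block coordinates one at a
time gives `height (ker (f ↦ f(a))) ≥ 4`.  (The tree's `VonZurGathen.five_le_height_of_block`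
adds vzG's polynomial `h`, which needs `char ≠ 2`.) [cite: BoraleviCarliniMichalekVentura2025, Cor. 3.2 (arXiv text p0006 L18–31)] -/
theorem four_le_height_of_block (a : ι × ι → L) {Rw Cl : Finset ι} {i₁ i₂ j₁ j₂ : ι}
    (hi : i₁ ≠ i₂) (hi₁ : i₁ ∉ Rw) (hi₂ : i₂ ∉ Rw) (h₁₂ : j₁ ≠ j₂) (hj₁ : j₁ ∉ Cl)
    (hj₂ : j₂ ∉ Cl) (hcard : Cl.card = Rw.card)
    (hg : (Matrix.of fun r c => a (r, c)).subperm (· ∈ Cl) (· ∈ Rw) ≠ 0)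
    (hvan : ∀ Rw' Cl' : Finset ι, Rw'.card = Rw.card + 1 → Cl'.card = Rw.card + 1 →
      (Matrix.of fun r c => a (r, c)).subperm (· ∈ Cl') (· ∈ Rw') = 0) :
    (4 : ℕ∞) ≤ (RingHom.ker (aeval (R := K) a)).height := by
  set pt : Finset (ι × ι) → ι × ι → MvPolynomial (ι × ι) L := fun T => T.piecewise X (C ∘ a)
    with hpt
  have hRi : ∀ {i'}, i' ∉ Rw → (insert i' Rw).card = Rw.card + 1 := fun h =>
    Finset.card_insert_of_notMem h
  have hCj : ∀ {j'}, j' ∉ Cl → (insert j' Cl).card = Rw.card + 1 := fun h => by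
    rw [Finset.card_insert_of_notMem h, hcard]
  set T₁ : Finset (ι × ι) := insert (i₁, j₁) ∅ with hT₁
  set T₂ : Finset (ι × ι) := insert (i₁, j₂) T₁ with hT₂
  set T₃ : Finset (ι × ι) := insert (i₂, j₁) T₂ with hT₃
  set T₄ : Finset (ι × ι) := insert (i₂, j₂) T₃ with hT₄
  have hB : ∀ r c, (r, c) ∈ T₄ → (r = i₁ ∨ r = i₂) ∧ (c = j₁ ∨ c = j₂) := by
    intro r c hx
    simp only [hT₄, hT₃, hT₂, hT₁, Finset.mem_insert, Prod.mk.injEq, Finset.notMem_empty,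
      or_false] at hx
    rcases hx with ⟨rfl, rfl⟩ | ⟨rfl, rfl⟩ | ⟨rfl, rfl⟩ | ⟨rfl, rfl⟩ <;> simp
  have hB₃ : ∀ r c, (r, c) ∈ T₃ → (r = i₁ ∨ r = i₂) ∧ (c = j₁ ∨ c = j₂) := fun r c hx =>
    hB r c (Finset.mem_insert_of_mem hx)
  have hB₂ : ∀ r c, (r, c) ∈ T₂ → (r = i₁ ∨ r = i₂) ∧ (c = j₁ ∨ c = j₂) := fun r c hx =>
    hB₃ r c (Finset.mem_insert_of_mem hx)
  have hB₁ : ∀ r c, (r, c) ∈ T₁ → (r = i₁ ∨ r = i₂) ∧ (c = j₁ ∨ c = j₂) := fun r c hx =>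
    hB₂ r c (Finset.mem_insert_of_mem hx)
  have step : ∀ (T : Finset (ι × ι)) (i' j' : ι), i' ∉ Rw → j' ∉ Cl →
      (∀ r c, (r, c) ∈ insert (i', j') T → (r = i₁ ∨ r = i₂) ∧ (c = j₁ ∨ c = j₂)) →
      (i', j') ∉ T →
      (RingHom.ker (aeval (R := K) (pt (insert (i', j') T)))).height + 1 ≤
        (RingHom.ker (aeval (R := K) (pt T))).height := by
    intro T i' j' hi' hj' hBT hnot
    refine height_ker_aeval_piecewise_insert a T (i', j')
      ((mvPolynomialX ι ι K).subperm (· ∈ insert j' Cl) (· ∈ insert i' Rw)) ?_ ?_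
    · have hT' : ∀ x ∈ T, x.1 ∈ insert i' Rw → x.2 ∈ insert j' Cl → False :=
        fun x hx hr hc => hnot (blockOK hi₁ hi₂ hj₁ hj₂
          (fun r c h => hBT r c (Finset.mem_insert_of_mem h)) i' j' x hx hr hc ▸ hx)
      rw [aeval_blockWitness_of_notMem a hT', hvan _ _ (hRi hi') (hCj hj'), map_zero]
    · rw [aeval_blockWitness_of_mem a hi' hj' (blockOK hi₁ hi₂ hj₁ hj₂ hBT i' j')
        (Finset.mem_insert_self _ _)]
      exact X_mul_C_add_C_ne_zero hg
  have s₁ := step ∅ i₁ j₁ hi₁ hj₁ hB₁ (Finset.notMem_empty _)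
  have s₂ := step T₁ i₁ j₂ hi₁ hj₂ hB₂ (by simp [hT₁, Ne.symm h₁₂])
  have s₃ := step T₂ i₂ j₁ hi₂ hj₁ hB₃ (by simp [hT₂, hT₁, Ne.symm hi])
  have s₄ := step T₃ i₂ j₂ hi₂ hj₂ hB (by simp [hT₃, hT₂, hT₁, Ne.symm hi, Ne.symm h₁₂])
  have b₄ : ((0 : ℕ) : ℕ∞) ≤ (RingHom.ker (aeval (R := K) (pt T₄))).height := by simp
  have b₀ := natCast_succ_le (natCast_succ_le (natCast_succ_le (natCast_succ_le b₄ s₄) s₃) s₂) s₁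
  rw [hpt, ker_aeval_piecewise_empty] at b₀
  exact le_of_eq_of_le (by norm_num) b₀

/-- **Cor. 3.2 at a point, any characteristic**: if all `(m−1) × (m−1)` subpermanents of an
`m × m` matrix `a` over a domain `L ⊇ K` vanish (`m ≥ 2`), then the prime `{f : f(a) = 0}` has
height `≥ 4`.  Reduction as in the tree's vzG file: `k ≤ m − 2` maximal with a nonzero `k × k`
subpermanent; `k = 0` means `a = 0` (`m² ≥ 4` vanishing coordinates), otherwise
`four_le_height_of_block`. [cite: BoraleviCarliniMichalekVentura2025, Cor. 3.2 (arXiv text p0006 L18–31)] -/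
theorem four_le_height_of_vanishing (hι : 2 ≤ Fintype.card ι) (a : ι × ι → L)
    (hvan1 : ∀ r c, (Matrix.of fun r c => a (r, c)).subperm (· ≠ c) (· ≠ r) = 0) :
    (4 : ℕ∞) ≤ (RingHom.ker (aeval (R := K) a)).height := by
  classical
  let Good : ℕ → Prop := fun j => ∃ Rw Cl : Finset ι, Rw.card = j ∧ Cl.card = j ∧
    (Matrix.of fun r c => a (r, c)).subperm (· ∈ Cl) (· ∈ Rw) ≠ 0
  have hGood0 : Good 0 := ⟨∅, ∅, rfl, rfl, by
    rw [Matrix.subperm_of_isEmpty _ (fun i => Finset.notMem_empty i)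
      (fun j => Finset.notMem_empty j)]
    exact one_ne_zero⟩
  have hGoodm : ¬ Good (Fintype.card ι - 1) := by
    rintro ⟨Rw, Cl, hR, hC, hne⟩
    obtain ⟨r, rfl⟩ := exists_eq_univ_erase_of_card (s := Rw) (by omega)
    obtain ⟨c, rfl⟩ := exists_eq_univ_erase_of_card (s := Cl) (by omega)
    apply hne
    rw [← hvan1 r c]
    exact Matrix.subperm_congr _ (fun i => by simp) (fun j => by simp)
  have hGk : Good (Nat.findGreatest Good (Fintype.card ι - 2)) :=
    Nat.findGreatest_spec (P := Good) (Nat.zero_le _) hGood0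
  have hkle : Nat.findGreatest Good (Fintype.card ι - 2) ≤ Fintype.card ι - 2 :=
    Nat.findGreatest_le _
  have hGk1 : ¬ Good (Nat.findGreatest Good (Fintype.card ι - 2) + 1) := by
    by_cases hk1 : Nat.findGreatest Good (Fintype.card ι - 2) + 1 ≤ Fintype.card ι - 2
    · exact Nat.findGreatest_is_greatest (Nat.lt_succ_self _) hk1
    · have h : Nat.findGreatest Good (Fintype.card ι - 2) + 1 = Fintype.card ι - 1 := by omega
      rw [h]
      exact hGoodm
  obtain ⟨Rw, Cl, hR, hC, hg⟩ := hGk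
  have hvan : ∀ Rw' Cl' : Finset ι, Rw'.card = Rw.card + 1 → Cl'.card = Rw.card + 1 →
      (Matrix.of fun r c => a (r, c)).subperm (· ∈ Cl') (· ∈ Rw') = 0 := by
    intro Rw' Cl' hR' hC'
    by_contra hne
    exact hGk1 ⟨Rw', Cl', by rw [hR', hR], by rw [hC', hR], hne⟩
  rcases Nat.eq_zero_or_pos (Nat.findGreatest Good (Fintype.card ι - 2)) with hk0 | hkpos
  · -- `k = 0`: all entries of `a` vanish
    have hR0 : Rw = ∅ := Finset.card_eq_zero.1 (by rw [hR, hk0])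
    have hzero : ∀ x ∈ (Finset.univ : Finset (ι × ι)), a x = 0 := by
      rintro ⟨r, c⟩ -
      have h := hvan {r} {c} (by rw [hR0, Finset.card_singleton, Finset.card_empty])
        (by rw [hR0, Finset.card_singleton, Finset.card_empty])
      rwa [subperm_singleton] at h
    refine le_trans ?_ (card_le_height_ker_aeval a Finset.univ hzero)
    rw [Finset.card_univ, Fintype.card_prod]
    have h4 : 2 * 2 ≤ Fintype.card ι * Fintype.card ι := Nat.mul_le_mul hι hι
    exact_mod_cast h4
  · -- main case: two spare rows and two spare columns
    obtain ⟨i₁, hi₁, i₂, hi₂, hi⟩ := Finset.one_lt_card.1 (show 1 < Rwᶜ.card by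
      rw [Finset.card_compl, hR]; omega)
    obtain ⟨j₁, hj₁, j₂, hj₂, hj⟩ := Finset.one_lt_card.1 (show 1 < Clᶜ.card by
      rw [Finset.card_compl, hC]; omega)
    rw [Finset.mem_compl] at hi₁ hi₂ hj₁ hj₂
    exact four_le_height_of_block a hi hi₁ hi₂ hj hj₁ hj₂ (by rw [hC, hR]) hg hvan

end Cor32


/-! ### §F. Theorem 2.1 (codimension clause): `codim P_{2,n} = n` -/

section Thm21

variable {R : Type*} [CommRing R] {ρ κ : Type*} [Fintype ρ] [Fintype κ] [DecidableEq ρ]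
  [DecidableEq κ]

/-- A `2 × 2` subpermanent: `per[{r₀,r₁} | {i,j}] = M r₀ i · M r₁ j + M r₀ j · M r₁ i`.
[cite: BurgisserClausenShokrollahi1997, (21.30)] -/
theorem rsubperm_pair (M : Matrix ρ κ R) {r₀ r₁ : ρ} {i j : κ} (hr : r₀ ≠ r₁) (hij : i ≠ j) :
    rsubperm M (· ∈ ({i, j} : Finset κ)) (· ∈ ({r₀, r₁} : Finset ρ)) =
      M r₀ i * M r₁ j + M r₀ j * M r₁ i := by
  rw [show ({r₀, r₁} : Finset ρ) = insert r₀ {r₁} from rfl,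
    rsubperm_insert_row M (show r₀ ∉ ({r₁} : Finset ρ) by simpa using hr),
    Finset.sum_pair hij, show ({i, j} : Finset κ).erase i = {j} by
      rw [Finset.erase_insert (by simpa using hij)],
    show ({i, j} : Finset κ).erase j = {i} by
      rw [Finset.pair_comm, Finset.erase_insert (by simpa using hij.symm)],
    rsubperm_singleton, rsubperm_singleton]

variable {K : Type*} [Field K] {L : Type*} [CommRing L] [IsDomain L] [Algebra K L]

/-- **Thm. 2.1 at a point** (codimension clause): if all `2 × 2` permanents
`u_i v_j + u_j v_i` (`i ≠ j`) of a `2 × n` matrix `(u; v)` over a domain `L ⊇ K` vanish,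
`n ≥ 3` and `2 ≠ 0` in `K`, then the prime `{f : f(u, v) = 0} ⊆ K[X_{2×n}]` has height `≥ n`.
Elementary case analysis replacing the printed appeal to the Laubenbacher–Swanson decomposition
[LS2000]: either a row vanishes (`n` zero coordinates), or `u_c v_c ≠ 0` for some `c`, and then
`u_i u_j = 0` for `i ≠ j` off `c` (from `u_c (u_i v_j + u_j v_i) = −2 u_i u_j v_c`), so at most
one further column `d` is nonzero: `2(n−2)` vanishing coordinates plus the relation
`u_c v_d + u_d v_c = 0` give `2n − 3 ≥ n` strict steps. [cite: BoraleviCarliniMichalekVentura2025, Thm. 2.1 (arXiv text p0005 L6–12)] -/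
theorem height_ker_aeval_ge_of_twoByN (h2 : (2 : K) ≠ 0) {n : ℕ} (hn : 3 ≤ n)
    (a : Fin 2 × Fin n → L)
    (hvan : ∀ i j : Fin n, i ≠ j → a (0, i) * a (1, j) + a (0, j) * a (1, i) = 0) :
    (n : ℕ∞) ≤ (RingHom.ker (aeval (R := K) a)).height := by
  classical
  have h2L : (2 : L) ≠ 0 := fun h =>
    h2 ((algebraMap K L).injective (by rw [map_ofNat, map_zero]; exact h))
  have zeros : ∀ T : Finset (Fin 2 × Fin n), (∀ x ∈ T, a x = 0) →
      (T.card : ℕ∞) ≤ (RingHom.ker (aeval (R := K) a)).height :=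
    fun T hT => card_le_height_ker_aeval a T hT
  have hrow : ∀ (r : Fin 2), (∀ j, a (r, j) = 0) →
      (n : ℕ∞) ≤ (RingHom.ker (aeval (R := K) a)).height := by
    intro r hr
    refine le_trans (le_of_eq ?_) (zeros (({r} : Finset (Fin 2)) ×ˢ Finset.univ) ?_)
    · rw [Finset.card_product, Finset.card_singleton, Finset.card_univ, Fintype.card_fin, one_mul]
    · intro x hx
      have hx1 : x.1 = r := Finset.mem_singleton.1 (Finset.mem_product.1 hx).1
      rw [show x = (r, x.2) from Prod.ext hx1 rfl]
      exact hr x.2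
  by_cases hu0 : ∀ j, a (0, j) = 0
  · exact hrow 0 hu0
  push Not at hu0
  obtain ⟨c, hc⟩ := hu0
  by_cases hvc : a (1, c) = 0
  · -- the second row vanishes
    refine hrow 1 fun j => ?_
    by_cases hjc : j = c
    · rw [hjc]; exact hvc
    · have h := hvan c j (Ne.symm hjc)
      rw [hvc, mul_zero, add_zero] at h
      exact (mul_eq_zero.1 h).resolve_left hc
  · -- `u_c v_c ≠ 0`: then `u_i u_j = 0` for distinct `i, j ≠ c`
    have huu : ∀ i j, i ≠ c → j ≠ c → i ≠ j → a (0, i) * a (0, j) = 0 := by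
      intro i j hic hjc hij
      have hi := hvan c i (Ne.symm hic)
      have hj := hvan c j (Ne.symm hjc)
      have hij' := hvan i j hij
      have key : a (0, c) * (a (0, i) * a (1, j) + a (0, j) * a (1, i)) =
          -(2 * (a (0, i) * a (0, j)) * a (1, c)) := by
        have e1 : a (0, c) * a (1, i) = -(a (0, i) * a (1, c)) := eq_neg_of_add_eq_zero_left hi
        have e2 : a (0, c) * a (1, j) = -(a (0, j) * a (1, c)) := eq_neg_of_add_eq_zero_left hj
        linear_combination a (0, i) * e2 + a (0, j) * e1
      rw [hij', mul_zero] at key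
      have h0 : 2 * (a (0, i) * a (0, j)) * a (1, c) = 0 := neg_eq_zero.1 key.symm
      rcases mul_eq_zero.1 h0 with h | h
      · rcases mul_eq_zero.1 h with h' | h'
        · exact absurd h' h2L
        · exact h'
      · exact absurd h hvc
    by_cases hud : ∀ j, j ≠ c → a (0, j) = 0
    · -- only the column `c` survives in row `0`; row `1` vanishes off `c` too
      have hv0 : ∀ j, j ≠ c → a (1, j) = 0 := by
        intro j hjc
        have h := hvan c j (Ne.symm hjc)
        rw [hud j hjc, zero_mul, add_zero] at h
        exact (mul_eq_zero.1 h).resolve_left hc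
      have hboth : ∀ (r : Fin 2) (j : Fin n), j ≠ c → a (r, j) = 0 :=
        Fin.forall_fin_two.2 ⟨hud, hv0⟩
      refine le_trans ?_ (zeros ((Finset.univ : Finset (Fin 2)) ×ˢ (Finset.univ.erase c)) ?_)
      · rw [Finset.card_product, Finset.card_univ, Fintype.card_fin,
          Finset.card_erase_of_mem (Finset.mem_univ _), Finset.card_univ, Fintype.card_fin]
        exact_mod_cast (by omega : n ≤ 2 * (n - 1))
      · rintro ⟨r, j⟩ hx
        exact hboth r j (Finset.mem_erase.1 (Finset.mem_product.1 hx).2).1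
    · push Not at hud
      obtain ⟨d, hdc, hd⟩ := hud
      have hu0' : ∀ j, j ≠ c → j ≠ d → a (0, j) = 0 := fun j hjc hjd =>
        (mul_eq_zero.1 (huu d j hdc hjc (Ne.symm hjd))).resolve_left hd
      have hv0' : ∀ j, j ≠ c → j ≠ d → a (1, j) = 0 := by
        intro j hjc hjd
        have h := hvan c j (Ne.symm hjc)
        rw [hu0' j hjc hjd, zero_mul, add_zero] at h
        exact (mul_eq_zero.1 h).resolve_left hc
      have hboth : ∀ (r : Fin 2) (j : Fin n), j ≠ c → j ≠ d → a (r, j) = 0 :=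
        Fin.forall_fin_two.2 ⟨hu0', hv0'⟩
      -- `2(n-2)` vanishing coordinates …
      set T₀ : Finset (Fin 2 × Fin n) :=
        (Finset.univ : Finset (Fin 2)) ×ˢ ((Finset.univ.erase c).erase d) with hT₀
      have hmemT₀ : ∀ x ∈ T₀, x.2 ≠ c ∧ x.2 ≠ d := by
        intro x hx
        have hj := (Finset.mem_product.1 hx).2
        exact ⟨(Finset.mem_erase.1 (Finset.mem_erase.1 hj).2).1, (Finset.mem_erase.1 hj).1⟩
      have hT₀zero : ∀ x ∈ T₀, a x = 0 := by
        rintro ⟨r, j⟩ hx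
        obtain ⟨hjc, hjd⟩ := hmemT₀ _ hx
        exact hboth r j hjc hjd
      have hT₀card : T₀.card = 2 * (n - 2) := by
        rw [hT₀, Finset.card_product, Finset.card_univ, Fintype.card_fin,
          Finset.card_erase_of_mem (Finset.mem_erase.2 ⟨hdc, Finset.mem_univ d⟩),
          Finset.card_erase_of_mem (Finset.mem_univ _), Finset.card_univ, Fintype.card_fin]
        omega
      have hz := height_ker_aeval_piecewise_add_card_le (K := K) a T₀ hT₀zero
      -- … and the relation `u_c v_d + u_d v_c = 0` frees `v_d` on top of them
      have h10 : (1 : Fin 2) ∉ ({0} : Finset (Fin 2)) := by simp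
      have hdc' : d ∉ ({c} : Finset (Fin n)) := by simpa using hdc
      have hstep := height_ker_aeval_piecewise_insert (K := K) a T₀ ((1 : Fin 2), d)
        (rsubperm (mvPolynomialX (Fin 2) (Fin n) K) (· ∈ insert d ({c} : Finset (Fin n)))
          (· ∈ insert (1 : Fin 2) ({0} : Finset (Fin 2)))) ?_ ?_
      rotate_left
      · rw [aeval_rowWitness_of_notMem a (fun x hx _ hxc => ?_)]
        · rw [rsubperm_pair _ (show (1 : Fin 2) ≠ 0 from by decide) hdc, map_eq_zero_iff _
            (C_injective _ _)]
          simp only [Matrix.of_apply]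
          linear_combination hvan c d hdc.symm
        · obtain ⟨hxc', hxd'⟩ := hmemT₀ x hx
          simp only [Finset.mem_insert, Finset.mem_singleton] at hxc
          exact hxc.elim hxd' hxc'
      · rw [aeval_rowWitness_of_mem a h10 hdc' (T := insert ((1 : Fin 2), d) T₀)
          (fun x hx _ hxc => ?_) (Finset.mem_insert_self _ _), rsubperm_singleton, Matrix.of_apply]
        · exact X_mul_C_add_C_ne_zero hc
        · rcases Finset.mem_insert.1 hx with h | h
          · exact h
          · obtain ⟨hxc', hxd'⟩ := hmemT₀ x h
            simp only [Finset.mem_insert, Finset.mem_singleton] at hxc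
            exact (hxc.elim hxd' hxc').elim
      -- count: `1 + 2(n-2) = 2n - 3 ≥ n`
      have h1 : (1 : ℕ∞) ≤ (RingHom.ker (aeval (R := K)
          (T₀.piecewise X (C ∘ a) : Fin 2 × Fin n → MvPolynomial (Fin 2 × Fin n) L))).height :=
        le_add_self.trans hstep
      have htot := (add_le_add h1 le_rfl).trans hz
      rw [ker_aeval_piecewise_empty, hT₀card] at htot
      refine le_trans ?_ htot
      have hle : n ≤ 1 + 2 * (n - 2) := by omega
      exact_mod_cast hle

end Thm21


/-- **The two ideals of the singular locus agree**: the tree's `VonZurGathen.singPermIdeal F m`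
`= (per_m, ∂per_m/∂x_ij)` is the ideal of the `(m−1) × (m−1)` permanents of the generic `m × m`
matrix (`∂per/∂x_{rc} = per x(r|c)`, and `per_m = Σ_c x_{rc} · per x(r|c)` by row expansion);
BCMV: "`Sing(P) = P_{k−1,k} = {prk(M) ≤ k−2}`". [cite: BoraleviCarliniMichalekVentura2025, Cor. 3.2, proof (arXiv text p0006 L21–24)] -/
theorem singPermIdeal_eq_subpermIdeal (F : Type*) [Field F] {m : ℕ} (hm : 1 ≤ m) :
    VonZurGathen.singPermIdeal F m = subpermIdeal F m m (m - 1) := by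
  classical
  have hgen : ∀ r c : Fin m, pderiv (r, c) (perPoly (Fin m) F) =
      rsubperm (mvPolynomialX (Fin m) (Fin m) F) (· ∈ Finset.univ.erase c)
        (· ∈ Finset.univ.erase r) := by
    intro r c
    rw [VonZurGathen.pderiv_perPoly, ← rsubperm_eq_subperm]
    exact rsubperm_congr _ (fun i => by simp) (fun j => by simp)
  apply le_antisymm
  · rw [VonZurGathen.singPermIdeal, Ideal.span_le]
    rintro f (rfl | ⟨⟨r, c⟩, rfl⟩)
    · -- `per_m = Σ_c x_{rc} per x(r|c)` for the row `r = ⟨0, hm⟩`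
      let r : Fin m := ⟨0, hm⟩
      have hper : perPoly (Fin m) F = rsubperm (mvPolynomialX (Fin m) (Fin m) F)
          (· ∈ (Finset.univ : Finset (Fin m))) (· ∈ insert r (Finset.univ.erase r)) := by
        rw [perPoly, ← Matrix.subperm_true, ← rsubperm_eq_subperm]
        exact rsubperm_congr _ (fun i => by simp) (fun j => by simp [Finset.insert_erase])
      rw [SetLike.mem_coe, hper, rsubperm_insert_row _ (Finset.notMem_erase r _)]
      refine Ideal.sum_mem _ fun c _ => Ideal.mul_mem_left _ _ ?_
      exact rsubperm_mem_subpermIdeal (by rw [Finset.card_erase_of_mem (Finset.mem_univ _),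
        Finset.card_univ, Fintype.card_fin]) (by rw [Finset.card_erase_of_mem (Finset.mem_univ _),
        Finset.card_univ, Fintype.card_fin])
    · rw [SetLike.mem_coe]
      change pderiv (r, c) (perPoly (Fin m) F) ∈ _
      rw [hgen]
      exact rsubperm_mem_subpermIdeal (by rw [Finset.card_erase_of_mem (Finset.mem_univ _),
        Finset.card_univ, Fintype.card_fin]) (by rw [Finset.card_erase_of_mem (Finset.mem_univ _),
        Finset.card_univ, Fintype.card_fin])
  · refine subpermIdeal_le_iff.2 fun Rw Cl hR hC => ?_
    obtain ⟨r, rfl⟩ := VonZurGathen.exists_eq_univ_erase_of_card (s := Rw)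
      (by rw [hR, Fintype.card_fin]; omega)
    obtain ⟨c, rfl⟩ := VonZurGathen.exists_eq_univ_erase_of_card (s := Cl)
      (by rw [hC, Fintype.card_fin]; omega)
    rw [← hgen]
    exact VonZurGathen.pderiv_perPoly_mem_singPermIdeal F m (r, c)

/-- **BCMV 2025, Corollary 3.2** ("Let `F` be an arbitrary field, `k ≥ 2`, and `M` a generic
`k × k` square matrix over `F`. Let `P = {perm(M) = 0}` be the permanental hypersurface, and
denote by `Sing(P)` its singular locus. Then `codim Sing(P) ≥ 4`."), height form at every
prime: every prime `P ⊇ singPermIdeal F k = (per_k, ∂per_k/∂x_ij)` of `F[X_{k×k}]` has height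
`≥ 4`, over EVERY field (in characteristic `2`, where `per = det`, this is sharp for `k ≥ 3`:
the rank-`≤ k−2` locus).  The tree's `vonzurGathen1987_singPerm_height_holds` gives `≥ 5` for
`k ≥ 3` when `2 ≠ 0`.  The irreducibility clause "in particular `perm(M)` is an irreducible
polynomial over `F`" is the tree's `perPoly_irreducible` (vzG Thm. 3.4; CITED, not restated).
[cite: BoraleviCarliniMichalekVentura2025, Cor. 3.2 (arXiv text p0006 L18–31)] -/
theorem cor_3_2 (F : Type*) [Field F] {k : ℕ} (hk : 2 ≤ k)
    (P : Ideal (MvPolynomial (Fin k × Fin k) F)) [P.IsPrime]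
    (hP : VonZurGathen.singPermIdeal F k ≤ P) : (4 : ℕ∞) ≤ P.height := by
  classical
  let a : Fin k × Fin k → MvPolynomial (Fin k × Fin k) F ⧸ P := fun x => Ideal.Quotient.mk P (X x)
  have hker := ker_aeval_quotientMk (K := F) P
  have hvan1 : ∀ r c, (Matrix.of fun r c => a (r, c)).subperm (· ≠ c) (· ≠ r) = 0 := by
    intro r c
    rw [← VonZurGathen.aeval_subperm_X (K := F) a, ← VonZurGathen.pderiv_perPoly,
      ← RingHom.mem_ker, hker]
    exact hP (VonZurGathen.pderiv_perPoly_mem_singPermIdeal F k (r, c))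
  rw [← hker]
  exact four_le_height_of_vanishing (by rw [Fintype.card_fin]; exact hk) a hvan1

/-- **BCMV 2025, Cor. 3.2, codimension form**: `ht (per_k, ∂per_k/∂x_ij) ≥ 4` for `k ≥ 2` over
every field (`codim Sing(P) ≥ 4`). [cite: BoraleviCarliniMichalekVentura2025, Cor. 3.2 (arXiv text p0006 L18–20)] -/
theorem cor_3_2_height (F : Type*) [Field F] {k : ℕ} (hk : 2 ≤ k) :
    (4 : ℕ∞) ≤ (VonZurGathen.singPermIdeal F k).height :=
  le_height_of_forall_isPrime fun P hP hle => by
    haveI := hP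
    exact cor_3_2 F hk P hle

/-- **BCMV 2025, Theorem 2.1 (codimension clause)** ("Let `M` be a generic `2 × n` matrix of
linear forms with `n ≥ 3`. The variety `ℙ(P_{2,n}) = ℙ({prk(M) ≤ 1}) ⊂ ℙ^{2n−1}` has codimension
`n`."), height form at every prime: every prime of `F[X_{2×n}]` containing the `2 × 2`
permanents of the generic `2 × n` matrix has height `≥ n`.  Typed: `(2 : F) ≠ 0` ⊋ the printed
standing hypothesis `char F = 0` (§2, p0005 L3); the clause "its singular locus has dimension
`1` and consists of `n²` lines" is NOT typed.  The printed proof invokes the Laubenbacher–Swanson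
decomposition of `P_{2,n}` [LS2000]; here an elementary case analysis at the generic point
(`height_ker_aeval_ge_of_twoByN`). [cite: BoraleviCarliniMichalekVentura2025, Thm. 2.1 (arXiv text p0005 L6–9)] -/
theorem thm_2_1 (F : Type*) [Field F] (h2 : (2 : F) ≠ 0) {n : ℕ} (hn : 3 ≤ n)
    (P : Ideal (MvPolynomial (Fin 2 × Fin n) F)) [P.IsPrime]
    (hP : subpermIdeal F 2 n 2 ≤ P) : (n : ℕ∞) ≤ P.height := by
  classical
  let a : Fin 2 × Fin n → MvPolynomial (Fin 2 × Fin n) F ⧸ P := fun x => Ideal.Quotient.mk P (X x)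
  have hker := ker_aeval_quotientMk (K := F) P
  have hvan : ∀ i j : Fin n, i ≠ j → a (0, i) * a (1, j) + a (0, j) * a (1, i) = 0 := by
    intro i j hij
    have h01 : (0 : Fin 2) ≠ 1 := Fin.zero_ne_one
    have hmem : rsubperm (mvPolynomialX (Fin 2) (Fin n) F) (· ∈ ({i, j} : Finset (Fin n)))
        (· ∈ ({0, 1} : Finset (Fin 2))) ∈ P :=
      hP (rsubperm_mem_subpermIdeal (Finset.card_pair h01) (Finset.card_pair hij))
    rw [← hker, RingHom.mem_ker, aeval_rsubperm_X, rsubperm_pair _ h01 hij] at hmem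
    simpa only [Matrix.of_apply] using hmem
  rw [← hker]
  exact height_ker_aeval_ge_of_twoByN h2 hn a hvan

/-- **BCMV 2025, Theorem 2.1, codimension form**: `ht I(P_{2,n}) = n` for `n ≥ 3` and `2 ≠ 0`
in `F` (`codim P_{2,n} = n`; the upper bound is the row component, Prop. 3.1).
[cite: BoraleviCarliniMichalekVentura2025, Thm. 2.1 (arXiv text p0005 L6–9)] -/
theorem thm_2_1_height (F : Type*) [Field F] (h2 : (2 : F) ≠ 0) {n : ℕ} (hn : 3 ≤ n) :
    (subpermIdeal F 2 n 2).height = n :=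
  le_antisymm (prop_3_1_upper F (by norm_num))
    (le_height_of_forall_isPrime fun P hP hle => by
      haveI := hP
      exact thm_2_1 F h2 hn P hle)

/-! ### §G. Lemma 3.3: the `h × h` permanents of a generic matrix are linearly independent -/

section Lemma33

variable {ρ κ : Type*} [Fintype ρ] [Fintype κ] [DecidableEq ρ] [DecidableEq κ] {R : Type*}
  [CommRing R]

/-- A subpermanent vanishes when no bijection from its columns to its rows is supported on the
nonzero entries. [cite: BurgisserClausenShokrollahi1997, (21.30)] -/
theorem rsubperm_eq_zero_of_forall_exists_zero (M : Matrix ρ κ R) {p : κ → Prop} {q : ρ → Prop}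
    [DecidablePred p] [DecidablePred q]
    (h : ∀ f : {i // p i} ≃ {j // q j}, ∃ i, M (f i) i = 0) : rsubperm M p q = 0 :=
  Finset.sum_eq_zero fun f _ => by
    obtain ⟨i, hi⟩ := h f
    exact Finset.prod_eq_zero (Finset.mem_univ i) hi

/-- **BCMV 2025, Lemma 3.3** ("Let `M` be a generic `k × n` matrix and let `h ≤ min{k, n}`. Then
the `h × h` permanents of `M` are linearly independent."), over any commutative coefficient ring
`F` (⊇ printed) and for every `h` (for `h > min{k,n}` the family is empty): the family of
`h × h` subpermanents `per[Rw | Cl](X)`, indexed by the pairs `(Rw, Cl)` with `|Rw| = |Cl| = h`,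
is `F`-linearly independent in `F[X_{k×n}]`.  Printed proof: each is determined by its diagonal
monomial; here: evaluating at the `0/1` pattern of one pair `(Rw, Cl)` kills every other
subpermanent and gives `1` on that one. [cite: BoraleviCarliniMichalekVentura2025, Lemma 3.3 (arXiv text p0006 L33–36)] -/
theorem lemma_3_3 (F : Type*) [CommRing F] (k n h : ℕ) :
    LinearIndependent F (fun RC : {RC : Finset (Fin k) × Finset (Fin n) //
        RC.1.card = h ∧ RC.2.card = h} =>
      rsubperm (mvPolynomialX (Fin k) (Fin n) F) (· ∈ RC.1.2) (· ∈ RC.1.1)) := by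
  classical
  rw [linearIndependent_iff']
  intro s g hsum RC hRC
  obtain ⟨⟨Rw, Cl⟩, hR, hC⟩ := RC
  -- the `0/1` pattern of a bijection `Cl ≃ Rw`
  have hcard : Fintype.card {c // c ∈ Cl} = Fintype.card {r // r ∈ Rw} := by simp [hR, hC]
  let e : {c // c ∈ Cl} ≃ {r // r ∈ Rw} := Fintype.equivOfCardEq hcard
  let v : Fin k × Fin n → F := fun rc =>
    if hc : rc.2 ∈ Cl then (if ((e ⟨rc.2, hc⟩ : {r // r ∈ Rw}) : Fin k) = rc.1 then 1 else 0)
    else 0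
  have hv1 : ∀ c : {c // c ∈ Cl}, v ((e c : Fin k), (c : Fin n)) = 1 := fun c => by
    simp [v, c.2]
  have hv0 : ∀ (r : Fin k) (c : Fin n), v (r, c) ≠ 0 →
      ∃ hc : c ∈ Cl, ((e ⟨c, hc⟩ : {r // r ∈ Rw}) : Fin k) = r := by
    intro r c hrc
    by_cases hc : c ∈ Cl
    · refine ⟨hc, ?_⟩
      by_contra hne
      exact hrc (by simp [v, hc, hne])
    · exact absurd (by simp [v, hc]) hrc
  -- value of the subpermanents at the pattern
  have hval : ∀ RC' : {RC : Finset (Fin k) × Finset (Fin n) // RC.1.card = h ∧ RC.2.card = h},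
      aeval v (rsubperm (mvPolynomialX (Fin k) (Fin n) F) (· ∈ RC'.1.2) (· ∈ RC'.1.1)) =
        if RC' = ⟨(Rw, Cl), hR, hC⟩ then 1 else 0 := by
    rintro ⟨⟨Rw', Cl'⟩, hR', hC'⟩
    rw [aeval_rsubperm_X]
    split_ifs with heq
    · simp only [Subtype.mk.injEq, Prod.mk.injEq] at heq
      obtain ⟨rfl, rfl⟩ := heq
      refine rsubperm_eq_one_of_pattern _ e (fun c => by simpa using hv1 c) (fun c r hr => ?_)
      simp only [Matrix.of_apply]
      by_contra hne
      obtain ⟨hc, hcr⟩ := hv0 _ _ hne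
      exact hr (Subtype.ext (by rw [← hcr]))
    · refine rsubperm_eq_zero_of_forall_exists_zero _ fun f => ?_
      by_contra hall
      push Not at hall
      simp only [Matrix.of_apply] at hall
      -- every column of `Cl'` is a column of `Cl`, and `f = e` there
      have hsub : ∀ c : {c // c ∈ Cl'}, ∃ hc : (c : Fin n) ∈ Cl,
          ((e ⟨c, hc⟩ : {r // r ∈ Rw}) : Fin k) = f c := fun c => hv0 _ _ (hall c)
      have hCl : Cl' = Cl := by
        refine Finset.eq_of_subset_of_card_le (fun c hc => (hsub ⟨c, hc⟩).1) (by rw [hC, hC'])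
      have hRw : Rw' = Rw := by
        refine Finset.eq_of_subset_of_card_le (fun r hr => ?_) (by rw [hR, hR'])
        obtain ⟨hc, hcr⟩ := hsub (f.symm ⟨r, hr⟩)
        have h1 : ((e ⟨_, hc⟩ : {r // r ∈ Rw}) : Fin k) = r := by
          rw [hcr, Equiv.apply_symm_apply]
        rw [← h1]
        exact (e ⟨_, hc⟩).2
      exact heq (Subtype.ext (Prod.ext hRw hCl))
  -- apply the evaluation to the dependence relation
  have h := congrArg (aeval v) hsum
  rw [map_sum, map_zero] at h
  simp only [map_smul, hval, smul_eq_mul, mul_ite, mul_one, mul_zero, Finset.sum_ite_eq',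
    if_pos hRC] at h
  exact h

end Lemma33

/-! ### §H. Lemma 3.11: `2 × 2` permanents of the circulant Hankel matrix -/

section Lemma311

variable {F : Type*} [Field F]

/-- **The key identity of Lemma 3.11** (BCMV p0007–p0008: "`1/2·(rel1) + 1/2·(rel2) − 1/2·(rel3)
= x_j² ∈ I(Q_1)`"): for `k ≥ 3` and `2 ≠ 0` in `F`, every `x_j²` lies in the ideal of the
`2 × 2` permanents of the `k × (k+1)` circulant Hankel matrix `(x_{i+j mod (k+1)})`.  The three
relations used: rows `{0,1}`/columns `{j, j−1}`, rows `{0,2}`/columns `{j, j−2}`, rows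
`{0,1}`/columns `{j+1, j−2}` (so `k ≥ 3`, i.e. `k + 1 ≥ 4`, is needed for the columns to be
distinct). [cite: BoraleviCarliniMichalekVentura2025, Lemma 3.11, proof (arXiv text p0007 L96 – p0008 L12)] -/
theorem lemma_3_11_sq_mem (h2 : (2 : F) ≠ 0) {k : ℕ} (hk : 3 ≤ k) (j : Fin (k + 1)) :
    (X j ^ 2 : MvPolynomial (Fin (k + 1)) F) ∈
      Ideal.span {f | ∃ (Rw : Finset (Fin k)) (Cl : Finset (Fin (k + 1))),
        Rw.card = 2 ∧ Cl.card = 2 ∧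
        f = rsubperm (Matrix.of fun (i : Fin k) (c : Fin (k + 1)) =>
          (X (Fin.castSucc i + c) : MvPolynomial (Fin (k + 1)) F)) (· ∈ Cl) (· ∈ Rw)} := by
  classical
  set H : Matrix (Fin k) (Fin (k + 1)) (MvPolynomial (Fin (k + 1)) F) :=
    Matrix.of fun (i : Fin k) (c : Fin (k + 1)) => (X (Fin.castSucc i + c)) with hH
  set I := Ideal.span {f | ∃ (Rw : Finset (Fin k)) (Cl : Finset (Fin (k + 1))),
        Rw.card = 2 ∧ Cl.card = 2 ∧ f = rsubperm H (· ∈ Cl) (· ∈ Rw)} with hI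
  -- the rows `0, 1, 2` and the shifts `s = 1`, `t = 2 = s + s`
  let r0 : Fin k := ⟨0, by omega⟩
  let r1 : Fin k := ⟨1, by omega⟩
  let r2 : Fin k := ⟨2, by omega⟩
  set s : Fin (k + 1) := Fin.castSucc r1 with hs
  set t : Fin (k + 1) := Fin.castSucc r2 with ht
  have hz : Fin.castSucc r0 = (0 : Fin (k + 1)) := rfl
  have hts : t = s + s := by
    rw [ht, hs, Fin.ext_iff, Fin.val_add]
    simp [r1, r2, Nat.mod_eq_of_lt (show 2 < k + 1 by omega)]
  have hs0 : s ≠ 0 := by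
    rw [hs, Ne, Fin.ext_iff]; simp [r1]
  have ht0 : t ≠ 0 := by
    rw [ht, Ne, Fin.ext_iff]; simp [r2]
  have hst0 : s + t ≠ 0 := by
    rw [ht, hs, Ne, Fin.ext_iff, Fin.val_add]
    simp [r1, r2, Nat.mod_eq_of_lt (show 3 < k + 1 by omega)]
  have h01 : r0 ≠ r1 := by simp [r0, r1, Fin.ext_iff]
  have h02 : r0 ≠ r2 := by simp [r0, r2, Fin.ext_iff]
  -- generators are in `I`
  have hgen : ∀ {a b : Fin k} {c d : Fin (k + 1)}, a ≠ b → c ≠ d →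
      rsubperm H (· ∈ ({c, d} : Finset (Fin (k + 1)))) (· ∈ ({a, b} : Finset (Fin k))) ∈ I :=
    fun hab hcd => Ideal.subset_span ⟨_, _, Finset.card_pair hab, Finset.card_pair hcd, rfl⟩
  -- the three relations
  have rel1 : rsubperm H (· ∈ ({j, j - s} : Finset (Fin (k + 1)))) (· ∈ ({r0, r1} : Finset (Fin k)))
      = X j * X j + X (j - s) * X (j + s) := by
    rw [rsubperm_pair H h01 (fun h => hs0 (sub_eq_self.1 h.symm))]
    simp only [hH, Matrix.of_apply, hz, zero_add, ← hs]
    congr 2 <;> congr 1 <;> abel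
  have rel2 : rsubperm H (· ∈ ({j, j - t} : Finset (Fin (k + 1)))) (· ∈ ({r0, r2} : Finset (Fin k)))
      = X j * X j + X (j - t) * X (j + t) := by
    rw [rsubperm_pair H h02 (fun h => ht0 (sub_eq_self.1 h.symm))]
    simp only [hH, Matrix.of_apply, hz, zero_add, ← ht]
    congr 2 <;> congr 1 <;> abel
  have rel3 : rsubperm H (· ∈ ({j + s, j - t} : Finset (Fin (k + 1))))
      (· ∈ ({r0, r1} : Finset (Fin k))) = X (j - s) * X (j + s) + X (j - t) * X (j + t) := by
    have hne : j + s ≠ j - t := fun h => hst0 (by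
      have h' : j + s - (j - t) = 0 := sub_eq_zero.2 h
      rw [← h']; abel)
    rw [rsubperm_pair H h01 hne]
    simp only [hH, Matrix.of_apply, hz, zero_add, ← hs, hts]
    rw [mul_comm (X (j + s))]
    congr 2 <;> congr 1 <;> abel
  -- `x_j² = ½ (rel1 + rel2 − rel3)`
  have hcomb : (X j ^ 2 : MvPolynomial (Fin (k + 1)) F) = C (2⁻¹ : F) *
      (rsubperm H (· ∈ ({j, j - s} : Finset (Fin (k + 1)))) (· ∈ ({r0, r1} : Finset (Fin k))) +
        rsubperm H (· ∈ ({j, j - t} : Finset (Fin (k + 1)))) (· ∈ ({r0, r2} : Finset (Fin k))) -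
        rsubperm H (· ∈ ({j + s, j - t} : Finset (Fin (k + 1))))
          (· ∈ ({r0, r1} : Finset (Fin k)))) := by
    rw [rel1, rel2, rel3]
    have h2C : (C (2⁻¹ : F) * 2 : MvPolynomial (Fin (k + 1)) F) = 1 := by
      rw [show (2 : MvPolynomial (Fin (k + 1)) F) = C 2 by rw [map_ofNat], ← map_mul,
        inv_mul_cancel₀ h2, map_one]
    linear_combination (-(X j ^ 2)) * h2C
  rw [hcomb]
  refine Ideal.mul_mem_left _ _ (Ideal.sub_mem _ (Ideal.add_mem _ ?_ ?_) ?_)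
  · exact hgen h01 (fun h => hs0 (sub_eq_self.1 h.symm))
  · exact hgen h02 (fun h => ht0 (sub_eq_self.1 h.symm))
  · exact hgen h01 (fun h => hst0 (by
      have h' : j + s - (j - t) = 0 := sub_eq_zero.2 h
      rw [← h']; abel))

/-- **BCMV 2025, Lemma 3.11** ("Let `k ≥ 2` and let `S = F[x_j]` be the polynomial ring in the
`k + 1` variables `x_j`… Let `M = (x_j)` be a `k × (k+1)` circulant Hankel matrix. Let
`Q_1 = {prk(M) ≤ 1}` be the variety whose ideal is generated by the `2 × 2` permanents of `M`.
Then `codim(Q_1) = k + 1`."), height form: the ideal of `2 × 2` permanents of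
`(x_{i+j mod (k+1)})_{i<k, j<k+1}` has height `k + 1`.  Typed ⊊ printed: `k ≥ 3` (the printed
`k = 2` case "can be checked similarly as in the proof of Proposition 2.3" is not typed) and
`(2 : F) ≠ 0` — §3 has no standing characteristic hypothesis but the printed proof divides by
`2` (and the statement fails in characteristic `2`, where these permanents are minors).
Proof as printed: every `x_j²` lies in the ideal (`lemma_3_11_sq_mem`), so every prime over it
contains all the variables (height `≥ k + 1`); `≤ k + 1` by Krull. [cite: BoraleviCarliniMichalekVentura2025, Lemma 3.11 (arXiv text p0007 L90–95)] -/
theorem lemma_3_11 (h2 : (2 : F) ≠ 0) {k : ℕ} (hk : 3 ≤ k) :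
    (Ideal.span {f | ∃ (Rw : Finset (Fin k)) (Cl : Finset (Fin (k + 1))),
        Rw.card = 2 ∧ Cl.card = 2 ∧
        f = rsubperm (Matrix.of fun (i : Fin k) (c : Fin (k + 1)) =>
          (X (Fin.castSucc i + c) : MvPolynomial (Fin (k + 1)) F)) (· ∈ Cl) (· ∈ Rw)}).height =
      k + 1 := by
  classical
  set H : Matrix (Fin k) (Fin (k + 1)) (MvPolynomial (Fin (k + 1)) F) :=
    Matrix.of fun (i : Fin k) (c : Fin (k + 1)) => (X (Fin.castSucc i + c)) with hH
  set I := Ideal.span {f | ∃ (Rw : Finset (Fin k)) (Cl : Finset (Fin (k + 1))),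
        Rw.card = 2 ∧ Cl.card = 2 ∧ f = rsubperm H (· ∈ Cl) (· ∈ Rw)} with hI
  apply le_antisymm
  · -- `≤ k + 1`: inside the ideal of the `k + 1` variables (Krull)
    let T : Finset (MvPolynomial (Fin (k + 1)) F) :=
      Finset.univ.image fun j : Fin (k + 1) => (X j : MvPolynomial (Fin (k + 1)) F)
    have hTcard : T.card ≤ k + 1 := by
      have h := Finset.card_image_le (s := Finset.univ)
        (f := fun j : Fin (k + 1) => (X j : MvPolynomial (Fin (k + 1)) F))
      rwa [Finset.card_univ, Fintype.card_fin] at h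
    have hX : ∀ j, (X j : MvPolynomial (Fin (k + 1)) F) ∈ Ideal.span (T : Set _) := fun j =>
      Ideal.subset_span (Finset.mem_coe.2 (Finset.mem_image_of_mem _ (Finset.mem_univ j)))
    have hle : I ≤ Ideal.span (T : Set _) := by
      rw [hI, Ideal.span_le]
      rintro f ⟨Rw, Cl, hR, hC, rfl⟩
      obtain ⟨a, b, hab, rfl⟩ := Finset.card_eq_two.1 hR
      obtain ⟨c, d, hcd, rfl⟩ := Finset.card_eq_two.1 hC
      rw [SetLike.mem_coe, rsubperm_pair H hab hcd]
      simp only [hH, Matrix.of_apply]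
      exact Ideal.add_mem _ (Ideal.mul_mem_left _ _ (hX _)) (Ideal.mul_mem_left _ _ (hX _))
    refine (height_le_card_of_le_span hle (span_ne_top_of_constantCoeff fun g hg => ?_)).trans
      (by exact_mod_cast hTcard)
    obtain ⟨j, -, rfl⟩ := Finset.mem_image.1 (Finset.mem_coe.1 hg)
    exact constantCoeff_X F _
  · -- `≥ k + 1`: every prime over `I` contains all variables
    refine le_height_of_forall_isPrime fun P hP hIP => ?_
    haveI := hP
    let a : Fin (k + 1) → MvPolynomial (Fin (k + 1)) F ⧸ P := fun x => Ideal.Quotient.mk P (X x)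
    have hker := ker_aeval_quotientMk (K := F) P
    have hzero : ∀ x ∈ (Finset.univ : Finset (Fin (k + 1))), a x = 0 := by
      intro x _
      have hx2 : (X x ^ 2 : MvPolynomial (Fin (k + 1)) F) ∈ P := hIP (lemma_3_11_sq_mem h2 hk x)
      have hx : (X x : MvPolynomial (Fin (k + 1)) F) ∈ P := hP.mem_of_pow_mem 2 hx2
      exact Ideal.Quotient.eq_zero_iff_mem.2 hx
    have h := card_le_height_ker_aeval (K := F) a Finset.univ hzero
    rw [Finset.card_univ, Fintype.card_fin, hker] at h
    exact_mod_cast h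

end Lemma311

/-! ### §I. Proposition 3.5: the `k × k` permanents of a generic `k × (k+1)` matrix are
algebraically independent -/

section Prop35

variable {ρ κ : Type*} [Fintype ρ] [Fintype κ] [DecidableEq ρ] [DecidableEq κ] {R : Type*}
  [CommRing R]

/-- A subpermanent supported on a permutation pattern is the product of the pattern entries.
[cite: BurgisserClausenShokrollahi1997, (21.30)] -/
theorem rsubperm_eq_prod_of_pattern (M : Matrix ρ κ R) {p : κ → Prop} {q : ρ → Prop}
    [DecidablePred p] [DecidablePred q] (e : {i // p i} ≃ {j // q j})
    (h0 : ∀ (i : {i // p i}) (j : {j // q j}), j ≠ e i → M j i = 0) :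
    rsubperm M p q = ∏ i : {i // p i}, M (e i) i := by
  unfold rsubperm
  rw [Finset.sum_eq_single e]
  · intro f _ hf
    obtain ⟨i, hi⟩ : ∃ i, f i ≠ e i := by
      by_contra hall
      push Not at hall
      exact hf (Equiv.ext hall)
    exact Finset.prod_eq_zero (Finset.mem_univ i) (h0 i (f i) hi)
  · intro h
    exact absurd (Finset.mem_univ e) h

/-- **Monomials with independent exponents are algebraically independent**: if the exponent map
`d ↦ Σ_i d_i • E_i` is injective on `ι →₀ ℕ`, the monomials `X^{E_i}` are algebraically
independent over any commutative ring (distinct monomials of a relation go to distinct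
monomials). [folklore] -/
private theorem algebraicIndependent_monomial_of_injective {ι σ : Type*} [Fintype ι]
    (E : ι → σ →₀ ℕ) (hE : Function.Injective fun d : ι →₀ ℕ => ∑ i, d i • E i) :
    AlgebraicIndependent R fun i => (monomial (E i) (1 : R) : MvPolynomial σ R) := by
  classical
  rw [algebraicIndependent_iff_injective_aeval]
  refine (injective_iff_map_eq_zero _).2 fun G hG => ?_
  have hexp : aeval (fun i => (monomial (E i) (1 : R) : MvPolynomial σ R)) G =
      ∑ d ∈ G.support, monomial (∑ i, d i • E i) (coeff d G) := by
    rw [MvPolynomial.aeval_def, MvPolynomial.eval₂_eq']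
    refine Finset.sum_congr rfl fun d _ => ?_
    simp_rw [monomial_pow, one_pow]
    rw [← monomial_sum_one, MvPolynomial.algebraMap_eq, C_mul_monomial, mul_one]
  ext d₀
  rw [coeff_zero]
  have h := congrArg (coeff (∑ i, d₀ i • E i)) hG
  rw [hexp, coeff_sum, coeff_zero, Finset.sum_eq_single d₀] at h
  · rwa [coeff_monomial, if_pos rfl] at h
  · intro d _ hne
    rw [coeff_monomial, if_neg (fun h' => hne (hE h'))]
  · intro hd₀
    rw [coeff_monomial, if_pos rfl]
    exact MvPolynomial.notMem_support_iff.1 hd₀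

/-- **BCMV 2025, Proposition 3.5** ("Let `M` be a generic `k × (k+1)` matrix with `k ≥ 1`. Then
the `k × k` permanents of `M` are algebraically independent."): the `k + 1` maximal permanents
`per[all rows | all columns but j](X)` of the generic `k × (k+1)` matrix are algebraically
independent over `F` — typed over ANY commutative ring `F` ⊇ printed (the printed proof, via
the nondegeneracy of the Mignon–Ressayre Hessian of `per_{k+1}` [MR2005] and Gordan–Noether
[libro_Russo], needs characteristic `0`; here instead the specialisation `M = [s·1_k | t]`
sends the permanents to the monomials `t_i s^{k−1}` (`i < k`) and `s^k`, whose exponent vectors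
are independent, and algebraic independence pulls back along the specialisation). [cite: BoraleviCarliniMichalekVentura2025, Prop. 3.5 (arXiv text p0006 L43–52)] -/
theorem prop_3_5 (F : Type*) [CommRing F] {k : ℕ} (hk : 1 ≤ k) :
    AlgebraicIndependent F (fun j : Fin (k + 1) =>
      rsubperm (mvPolynomialX (Fin k) (Fin (k + 1)) F) (· ∈ Finset.univ.erase j)
        (· ∈ (Finset.univ : Finset (Fin k)))) := by
  classical
  -- the specialisation `M = [s·1 | t]`, `s = X (last k)`, `t_i = X (castSucc i)`
  let v : Fin k × Fin (k + 1) → MvPolynomial (Fin (k + 1)) F := fun p =>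
    if p.2 = Fin.castSucc p.1 then X (Fin.last k)
    else if p.2 = Fin.last k then X (Fin.castSucc p.1) else 0
  -- exponents of the specialised permanents
  let E : Fin (k + 1) → Fin (k + 1) →₀ ℕ := fun j =>
    if j = Fin.last k then Finsupp.single (Fin.last k) k
    else Finsupp.single j 1 + Finsupp.single (Fin.last k) (k - 1)
  refine AlgebraicIndependent.of_comp (aeval v) ?_
  -- (1) the specialised permanents are the monomials `X^{E j}`
  have hval : (aeval v) ∘ (fun j : Fin (k + 1) =>
      rsubperm (mvPolynomialX (Fin k) (Fin (k + 1)) F) (· ∈ Finset.univ.erase j)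
        (· ∈ (Finset.univ : Finset (Fin k)))) =
      fun j => (monomial (E j) (1 : F) : MvPolynomial (Fin (k + 1)) F) := by
    funext j
    simp only [Function.comp_apply, aeval_rsubperm_X]
    have hv_diag : ∀ i : Fin k, v (i, Fin.castSucc i) = X (Fin.last k) := fun i => by simp [v]
    have hv_last : ∀ i : Fin k, v (i, Fin.last k) = X (Fin.castSucc i) := fun i => by
      simp [v, (Fin.castSucc_lt_last i).ne']
    have hv_zero : ∀ (i : Fin k) (c : Fin (k + 1)), c ≠ Fin.castSucc i → c ≠ Fin.last k →
        v (i, c) = 0 := fun i c h1 h2 => by simp [v, h1, h2]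
    -- the diagonal pattern on the columns `castSucc '' S` and rows `S`
    have hpat : ∀ (S : Finset (Fin k)),
        rsubperm (Matrix.of fun r c => v (r, c)) (· ∈ S.map Fin.castSuccEmb) (· ∈ S) =
          X (Fin.last k) ^ S.card := by
      intro S
      let e : {c // c ∈ S.map Fin.castSuccEmb} ≃ {r // r ∈ S} :=
        { toFun := fun c => ⟨(c : Fin (k + 1)).castPred (by
              obtain ⟨r, hr, hrc⟩ := Finset.mem_map.1 c.2
              rw [← hrc]
              exact (Fin.castSucc_lt_last r).ne), by
              obtain ⟨r, hr, hrc⟩ := Finset.mem_map.1 c.2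
              have : (c : Fin (k + 1)) = Fin.castSucc r := hrc.symm
              simp only [this, Fin.castPred_castSucc]
              exact hr⟩
          invFun := fun r => ⟨Fin.castSucc r, Finset.mem_map.2 ⟨r, r.2, rfl⟩⟩
          left_inv := fun c => Subtype.ext (by simp)
          right_inv := fun r => Subtype.ext (by simp) }
      rw [rsubperm_eq_prod_of_pattern _ e (fun c r hr => ?_)]
      · have hfac : ∀ c : {c // c ∈ S.map Fin.castSuccEmb},
            (Matrix.of fun r c => v (r, c)) ((e c : {r // r ∈ S}) : Fin k) (c : Fin (k + 1)) =
              X (Fin.last k) := by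
          intro c
          rw [Matrix.of_apply]
          have hc : (c : Fin (k + 1)) = Fin.castSucc ((e c : {r // r ∈ S}) : Fin k) := by
            simp [e]
          conv_lhs => rw [hc]
          exact hv_diag _
        rw [Finset.prod_congr rfl fun c _ => hfac c, Finset.prod_const]
        simp only [Finset.card_univ, Fintype.card_coe, Finset.card_map]
      · simp only [Matrix.of_apply]
        refine hv_zero _ _ (fun h => hr (Subtype.ext ?_)) ?_
        · simp [e, h]
        · obtain ⟨r', _, hrc⟩ := Finset.mem_map.1 c.2
          rw [← hrc]
          exact (Fin.castSucc_lt_last r').ne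
    by_cases hj : j = Fin.last k
    · -- delete the last column: `per (s·1) = s^k`
      subst hj
      have hcols : ∀ c : Fin (k + 1), c ∈ Finset.univ.erase (Fin.last k) ↔
          c ∈ (Finset.univ : Finset (Fin k)).map Fin.castSuccEmb := by
        intro c
        simp only [Finset.mem_erase, Finset.mem_univ, and_true, Finset.mem_map, true_and,
          Fin.coe_castSuccEmb]
        constructor
        · intro h; exact ⟨c.castPred h, Fin.castSucc_castPred _ _⟩
        · rintro ⟨r, rfl⟩; exact (Fin.castSucc_lt_last r).ne
      rw [rsubperm_congr _ hcols (fun _ => Iff.rfl), hpat, Finset.card_univ, Fintype.card_fin,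
        X_pow_eq_monomial]
      simp [E]
    · -- delete the column `castSucc i₀`: expand along the row `i₀`
      obtain ⟨i₀, rfl⟩ : ∃ i₀ : Fin k, Fin.castSucc i₀ = j :=
        ⟨j.castPred hj, Fin.castSucc_castPred _ _⟩
      have hrows : ∀ r : Fin k, r ∈ (Finset.univ : Finset (Fin k)) ↔
          r ∈ insert i₀ (Finset.univ.erase i₀) := fun r => by simp [Finset.insert_erase]
      rw [rsubperm_congr _ (fun _ => Iff.rfl) hrows,
        rsubperm_insert_row _ (Finset.notMem_erase i₀ _),
        Finset.sum_eq_single (Fin.last k)]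
      · have hcols : ∀ c : Fin (k + 1),
            c ∈ (Finset.univ.erase (Fin.castSucc i₀)).erase (Fin.last k) ↔
              c ∈ (Finset.univ.erase i₀).map Fin.castSuccEmb := by
          intro c
          simp only [Finset.mem_erase, Finset.mem_univ, and_true, Finset.mem_map,
            Fin.coe_castSuccEmb]
          constructor
          · rintro ⟨h1, h2⟩
            exact ⟨c.castPred h1, fun h => h2 (by rw [← h, Fin.castSucc_castPred]),
              Fin.castSucc_castPred _ _⟩
          · rintro ⟨r, hr, rfl⟩
            exact ⟨(Fin.castSucc_lt_last r).ne, fun h => hr (Fin.castSucc_injective _ h)⟩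
        rw [Matrix.of_apply, hv_last, rsubperm_congr _ hcols (fun _ => Iff.rfl), hpat,
          Finset.card_erase_of_mem (Finset.mem_univ _), Finset.card_univ, Fintype.card_fin,
          X_pow_eq_monomial, show (X (Fin.castSucc i₀) : MvPolynomial (Fin (k + 1)) F) =
            monomial (Finsupp.single (Fin.castSucc i₀) 1) 1 by rw [← pow_one (X _), X_pow_eq_monomial],
          monomial_mul, one_mul]
        simp [E, (Fin.castSucc_lt_last i₀).ne]
      · intro c hc hne
        rw [Matrix.of_apply, hv_zero i₀ c (Finset.mem_erase.1 hc).1 hne, zero_mul]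
      · intro h
        exact absurd (Finset.mem_erase.2 ⟨(Fin.castSucc_lt_last i₀).ne', Finset.mem_univ _⟩) h
  rw [hval]
  -- (2) the exponent map is injective
  refine algebraicIndependent_monomial_of_injective E fun d d' hdd' => ?_
  have happly : ∀ (d : Fin (k + 1) →₀ ℕ) (x : Fin (k + 1)),
      (∑ i, d i • E i) x = ∑ i, d i * E i x := fun d x => by
    simp [Finset.sum_apply']
  have hEcast : ∀ (j : Fin (k + 1)) (i : Fin k), E j (Fin.castSucc i) =
      if j = Fin.castSucc i then 1 else 0 := by
    intro j i
    by_cases hj : j = Fin.last k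
    · simp [E, hj, (Fin.castSucc_lt_last i).ne, (Fin.castSucc_lt_last i).ne']
    · by_cases hji : j = Fin.castSucc i
      · simp [E, hji, (Fin.castSucc_lt_last i).ne]
      · simp [E, hj, hji, (Fin.castSucc_lt_last i).ne, Ne.symm hji]
  have hElast : ∀ (j : Fin (k + 1)), E j (Fin.last k) = if j = Fin.last k then k else k - 1 := by
    intro j
    by_cases hj : j = Fin.last k
    · simp [E, hj]
    · simp [E, hj]
  -- coordinates `castSucc i` recover `d (castSucc i)`
  have hcast : ∀ i : Fin k, d (Fin.castSucc i) = d' (Fin.castSucc i) := by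
    intro i
    have h := congrArg (fun f : Fin (k + 1) →₀ ℕ => f (Fin.castSucc i)) hdd'
    simp only [happly, hEcast, mul_ite, mul_one, mul_zero, Finset.sum_ite_eq',
      Finset.mem_univ, if_true] at h
    exact h
  -- the last coordinate recovers `d (last k)`
  have hsumc : ∑ i : Fin k, d (Fin.castSucc i) = ∑ i : Fin k, d' (Fin.castSucc i) :=
    Finset.sum_congr rfl fun i _ => hcast i
  have hlast : d (Fin.last k) = d' (Fin.last k) := by
    have h := congrArg (fun f : Fin (k + 1) →₀ ℕ => f (Fin.last k)) hdd'
    simp only [happly] at h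
    rw [Fin.sum_univ_castSucc, Fin.sum_univ_castSucc] at h
    simp only [hElast, (Fin.castSucc_lt_last _).ne, if_false, if_true] at h
    rw [← Finset.sum_mul, ← Finset.sum_mul, hsumc] at h
    have h' : d (Fin.last k) * k = d' (Fin.last k) * k := by omega
    exact Nat.eq_of_mul_eq_mul_right (by omega) h'
  ext x
  induction x using Fin.lastCases with
  | last => exact hlast
  | cast i => exact hcast i

end Prop35

end BoraleviCarliniMichalekVentura2025

end Literature.Computability.AlgebraicComplexity
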